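import Mathlib
import Literature.MathematicalPhysics.QuantumFieldTheory.Balaban1983to89.B4Sect5Proof
import Literature.MathematicalPhysics.QuantumFieldTheory.Balaban1983to89.B4TorusKernel

/-!
# The Sect. 5 Theorem of B4 on an arbitrary finite index set, and ON THE TORUS — the reading B6 uses at
(2.152) (Λ = the whole lattice T^{(k)}), kernel-proved with size-independent constants

T. Bałaban, *Regularity and decay of lattice Green's functions*, Commun. Math. Phys. **89** (1983) 571–597
[Balaban1983RegularityDecay] (= B4; reference [3] of B6), Sect. 5 "A General Theorem on Unit Lattice Operators",
p. 594 [PDF 24] and p. 597 [PDF 27], read from the ×2 page renders (journal page = PDF page + 570;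
`run/shared/lean/pub/pub-balaban/b2b-balaban-ref1/pages/1983-cmp89-regularity-decay/…-p024-x2.png`, `…-p027-x2.png`);
use site: T. Bałaban, *Propagators and renormalization transformations for lattice gauge theories. II*, Commun.
Math. Phys. **96** (1984) 223–250 [Balaban1984PropagatorsII] (= B6), pp. 249–250 [PDF 27–28].
Unit b2b-balaban-pv09-g4 (surge node prover #09, gen 4, cell pub-balaban; journal claim G-pv09g2-1-vi-KERNEL =
B4-SECT5-TORUS; GAPS row G-pv09g2-1 residual (vi) of this lineage's module `…B6FromB4`, TYPING REMARK (iii)).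

VALUE = a kernel-checked certificate for a LOCATED GAP (the torus reading of a published finite-dimensional
theorem), NOT summit progress.  Nothing landed is edited: `…B4Sect5Proof` (unit pv23-g3: the ℤ^d theorem
`B4.Sect5ThmUniform d N` kernel-proved, its constants and elementary lemmas), `…QGQInverse` (unit r1-g3: the finite
Combes–Thomas bound `inverse_decay`), `…B4TorusKernel` (unit pv17: the circular distance `MultiPeriod.circAbs N x =
dist(x, Nℤ)`) are imported.

## The printed theorem (verbatim, p. 594 [PDF 24]) and the closing sentence of its proof (p. 597 [PDF 27])

*"Theorem. Let Ω ⊂ Z^d and let A be a symmetric operator defined on the space L²(Ω) of functions φ : Ω → R^N and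
satisfying the following condition: there exist positive constants γ₀, c₀, δ₀ such that
A ≥ γ₀I, |A(x, x′)| ≤ c₀e^{−δ₀|x−x′|}, x, x′ ∈ Ω. (5.6)
Then there exist positive constants c₁, δ₁ such that for arbitrary Λ ⊂ Ω and for C_Λ = A_Λ^{−1}, A_Λ is an operator
defined on L²(Λ) by A_Λ = ΛAΛ. We have
|C_Λ(x, x′)| ≤ c₁e^{−δ₁|x−x′|}, x, x′ ∈ Λ, (5.7)
|δC_Λ(x, x′)| ≤ c₁e^{−δ₁(|x−x′| + dist(x, Λ^c) + dist(x′, Λ^c))}, δC_Λ = C_Λ − C_Ω. (5.8)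
If we perturb the operator A by an operator B such that the condition (5.6) is satisfied for A + B, and additionally
B has the property
|B(x, x′)| ≤ c₀e^{−δ₀(|x−x′| + dist(x, Ω^c) + dist(x′, Ω^c))}, x, x′ ∈ Ω, (5.9)
then we have also
|A_Λ^{−1}(x, x′) − (A + B)_Λ^{−1}(x, x′)| ≤ c₁e^{−δ₁(|x−x′| + dist(x, Ω^c) + dist(x′, Ω^c))}, x, x′ ∈ Λ. (5.10)"*
— and, p. 597: *"Thus Inequality (5.10) is proved. The constants δ₁, c₁ are functions of δ₀, γ₀, c₀, and from the
above proof we can get more precise estimates for them."*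

## The use site on the torus (B6 pp. 249–250 [PDF 27–28], verbatim)

(2.152) is the Gaussian integral over the fields *"on the whole lattice T^{(k)}"* (a torus) *"or on a subset Λ"*;
p. 250: *"The inequality (2.153) implies ⟨B′, C\*Δ_kCB′⟩ ≥ (γ₀/12d²)L^{−d−1}‖CB′‖² ≥ γ′₀‖B′‖², (2.157) where γ′₀ =
(γ₀/12d²)L^{−d−1}. C is a short-ranged operator, so C\*Δ_kC has the same exponential decay as Δ_k. Now we may apply
the theory developed in Sect. 5 of [3] on unit lattice operators. It gives us an exponential decay, and all the other
properties, for the operator (C\*Δ_kC)⁻¹, hence for C^{(k)}_Λ also."*  The theorem of [3] is PRINTED for Ω ⊂ Z^d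
with the lattice distance; at this site it is USED on a torus (row G-pv09g2-1 (vi); `…B6FromB4` TYPING REMARK
(iii); `…B4Sect5Proof` "What this does NOT do").

## What is kernel-checked here (0 sorry; axioms propext / Classical.choice / Quot.sound only)

(A) §§1–7: **the Sect. 5 Theorem over an ARBITRARY FINITE INDEX SET** `n` carrying a pseudo-distance
`ρ : n → n → ℝ` (symmetric, `ρ x x = 0`, triangle inequality — `IsPseudoDist`) whose exponential sums are bounded by a
PROFILE `K : ℝ → ℝ` (nonnegative on positive rates), `Σ_y e^{−aρ(x,y)} ≤ K(a)` for all `a > 0` (`SumBound`).  Statement (`sect5_uniform`,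
`Sect5Uniform`/`sect5Uniform_holds`): for every `(γ₀, c₀, δ₀)` and profile `K` there are EXPLICIT `c₁* = cSt K γ₀ c₀ δ₀`,
`δ₁* = dSt K γ₀ c₀ δ₀ > 0` — chosen BEFORE the instance — such that for every such `(n, ρ)`, every `A` with (5.6)
(`Hyp56 ρ A γ₀ c₀ δ₀`: symmetry, `A ≥ γ₀I` as a real quadratic form, `|A(x,x′)| ≤ c₀e^{−δ₀ρ(x,x′)}`) and every
COMPRESSION `A_Λ = A.submatrix e e` along an INJECTION `e : m → n` (Λ = range e; so the elimination of an arbitrary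
sub-family of variables — single bonds, single components — is a compression): (5.7) `|A_Λ⁻¹(x,x′)| ≤
c₁*e^{−δ₁*ρ(x,x′)}`; (5.8) `|A_Λ⁻¹(x,x′) − A⁻¹(x,x′)| ≤ c₁*e^{−δ₁*(ρ(x,x′) + β(x) + β(x′))}` for EVERY nonnegative
`β` on Λ dominated by the distances to Λᶜ (`β(x) ≤ ρ(x,z)`, `z ∉ Λ`; the printed `dist(x, Λᶜ)` is the largest such
β); (5.10) `|A_Λ⁻¹(x,x′) − (A+B)_Λ⁻¹(x,x′)| ≤ c₁*e^{−δ₁*(ρ(x,x′) + ω(x) + ω(x′))}` whenever `A + B` satisfies (5.6)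
and `|B(x,x′)| ≤ c₀e^{−δ₀(ρ(x,x′) + ω(x) + ω(x′))}` (5.9) for a nonnegative `ρ`-Lipschitz potential `ω` (the printed
`dist(x, Ωᶜ)` is one).  ROUTE = that of `…B4Sect5Proof` (NOT the printed random-walk expansion (5.11)–(5.27)):
finite Combes–Thomas (`QGQInverse.inverse_decay`) fed by the weighted sums `Σ_{x′}|A(x,x′)|(e^{κρ} − 1) ≤ κM₀`,
`M₀ = c₀(4/δ₀)K(δ₀/2)`, `κ ≤ δ₀/4` (§3–§4); the exact block identity `A_Λ⁻¹ − A⁻¹|_Λ = A_Λ⁻¹·(ΛA Λᶜ)·(A⁻¹|_{Λᶜ×Λ})`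
(§5, `deltaC_eq`); the second resolvent identity (§6).  Constants: `δ₁ = min{δ₀/4, γ₀/(2M₀+1)}`, `δ₁* = δ₁/4`,
`c₁* = max{2/γ₀, (2/γ₀)²c₀K(δ₁/2)²}` — the formulas of `B4Sect5Proof.sect5_explicit` with `N·K_d(a)` replaced by the
profile `K(a)` (`constants_agree_cStar`, `constants_agree_deltaStar`: on ℤ^d they are literally the same numbers).
(B) §8–§9: **THE TORUS INSTANCE.**  Sites `(i : Fin d) → Fin (P i)` of the discrete torus `Π_i ℤ/P_iℤ` (period vector
`P`, all `P i ≥ 1`), `N` components, the sup-circular distance `tdist P x y = max_i dist(x_i − y_i, P_iℤ)` (pv17's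
`circAbs`; symmetry `circAbs_neg` and the triangle inequality `circAbs_add_le` are proved here); the torus lattice sums
obey `Σ_y e^{−a·tdist(x,y)} ≤ N·K_d(a)`, `K_d(a) = (2/(1 − e^{−a/d}))^d`, UNIFORMLY IN THE PERIOD VECTOR (`torusSum_le`,
`torusIdxSum_le`).  Hence (`torusSect5ThmUniform_holds : ∀ d N, TorusSect5ThmUniform d N`) the theorem of [3] holds
VERBATIM on every torus region `Ω ⊆ Π_iℤ/P_iℤ` (Ω = the whole torus included: (2.152)), for all `Λ ⊆ Ω`, with
`Λᶜ = Ω ∖ Λ`, `Ωᶜ = torus ∖ Ω` and torus distances throughout, with the SAME pair `(cStar d N, deltaStar d N)` that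
serves ℤ^d — in particular independent of the size of the torus; `TorusEngine`/`torusEngine_holds` is the form the (S5) sentence uses
((5.7) for A itself: "an exponential decay … for the operator (C\*Δ_kC)⁻¹").
(C) §10: consistency — the printed ℤ^d theorem is the instance `n = B4.Idx Ω N`, `ρ` = sup-distance of ℤ^d,
`K(a) = N·K_d(a)`: `B4.Hyp56` IS `Hyp56` (`hyp56_iff_B4`), the profile bound holds (`zrho_sumBound`), the printed
boundary distances are admissible potentials (`zd_beta_admissible`, `zd_omega_lipschitz`), and the constants are
LITERALLY pv23's (`constants_agree_cStar/deltaStar`, by `rfl`); `B4.Sect5ThmUniform d N` itself is already landed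
(`B4Sect5Proof.sect5ThmUniform_holds`) and is not re-derived.

## What this does NOT do

It asserts nothing printed beyond the quotations above; it does not re-type the B6-side consumers
(`B6FromB4.Reduction`, `B6BondElimination`, `B6WeightedEncoding` stay typed over Ω ⊂ ℤ^d — a torus-indexed use-site
wrapper for (2.152)–(2.157) is a separate, elementary successor item); it does not certify the printed random-walk
proof or its constants; block-norm vs entrywise kernel bounds as in `…B4` (D-b04.6).
-/

namespace Literature.MathematicalPhysics.QuantumFieldTheory.Balaban1983to89.B4Sect5Torus

open Finset Real Matrix

/-! ## §1  Pseudo-distances and lattice-sum profiles on a finite index set -/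

section Abstract

variable {n : Type*} [Fintype n] [DecidableEq n]

/-- A pseudo-distance on an index set: symmetric, zero on the diagonal, triangle inequality (nonnegativity
follows).  The sup-distance of ℤ^d restricted to Ω × {1,…,N} and the torus distance are instances. [folklore] -/
structure IsPseudoDist (ρ : n → n → ℝ) : Prop where
  symm : ∀ x y, ρ x y = ρ y x
  zero : ∀ x, ρ x x = 0
  triangle : ∀ x y z, ρ x z ≤ ρ x y + ρ y z

namespace IsPseudoDist

omit [Fintype n] [DecidableEq n] in
/-- A pseudo-distance is nonnegative. [folklore] -/
theorem nonneg {ρ : n → n → ℝ} (h : IsPseudoDist ρ) (x y : n) : 0 ≤ ρ x y := by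
  have h1 := h.triangle x y x
  rw [h.zero, h.symm y x] at h1
  linarith

omit [Fintype n] [DecidableEq n] in
/-- Pulling a pseudo-distance back along any map of index sets. [folklore] -/
theorem comp {ρ : n → n → ℝ} (h : IsPseudoDist ρ) {m : Type*} (e : m → n) :
    IsPseudoDist (fun i j => ρ (e i) (e j)) :=
  ⟨fun _ _ => h.symm _ _, fun _ => h.zero _, fun _ _ _ => h.triangle _ _ _⟩

end IsPseudoDist

/-- The lattice-sum PROFILE hypothesis: `Σ_y e^{−aρ(x,y)} ≤ K(a)` for every rate `a > 0` and every centre `x`.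
On ℤ^d (finite Ω, N components) and on every discrete torus `K(a) = N·(2/(1 − e^{−a/d}))^d` serves
(`B4Sect5Proof.idxSum_le`, `torusIdxSum_le`). [folklore] -/
def SumBound (ρ : n → n → ℝ) (K : ℝ → ℝ) : Prop :=
  ∀ a : ℝ, 0 < a → ∀ x : n, ∑ y, Real.exp (-(a * ρ x y)) ≤ K a

omit [DecidableEq n] in
/-- Sums over `n` of a function vanishing off the range of an injection `e : m → n` are sums over `m`. [folklore] -/
theorem sum_eq_sum_range {m : Type*} [Fintype m] {e : m → n} (he : Function.Injective e) (F : n → ℝ)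
    (hF : ∀ p, (¬ ∃ i, e i = p) → F p = 0) : ∑ p, F p = ∑ i, F (e i) := by
  have h1 : ∑ i, F (e i) = ∑ p ∈ Finset.univ.map ⟨e, he⟩, F p := by
    rw [Finset.sum_map]; rfl
  rw [h1]
  symm
  apply Finset.sum_subset (Finset.subset_univ _)
  intro p _ hp
  apply hF
  rintro ⟨i, hi⟩
  exact hp (Finset.mem_map.mpr ⟨i, Finset.mem_univ _, hi⟩)

omit [DecidableEq n] in
/-- The profile bound passes to the range of an injection (a sub-sum of nonnegative terms). [folklore] -/
theorem SumBound.comp {ρ : n → n → ℝ} {K : ℝ → ℝ} (h : SumBound ρ K) {m : Type*} [Fintype m]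
    {e : m → n} (he : Function.Injective e) : SumBound (fun i j : m => ρ (e i) (e j)) K := by
  intro a ha i
  have h1 : ∑ j, Real.exp (-(a * ρ (e i) (e j))) =
      ∑ y ∈ Finset.univ.map ⟨e, he⟩, Real.exp (-(a * ρ (e i) y)) := by
    rw [Finset.sum_map]; rfl
  rw [h1]
  exact (Finset.sum_le_sum_of_subset_of_nonneg (Finset.subset_univ _)
    (fun _ _ _ => (Real.exp_pos _).le)).trans (h a ha (e i))

/-! ## §2  Conditions (5.6) and (5.9) over an index set with a pseudo-distance -/

/-- Condition **(5.6)** of [3] p. 594 (*"A ≥ γ₀I, |A(x,x′)| ≤ c₀e^{−δ₀|x−x′|}, x, x′ ∈ Ω"* for *"a symmetric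
operator"*) with the printed distance `|x − x′|` replaced by an arbitrary pseudo-distance `ρ` on the index set:
symmetry of the kernel, the real quadratic-form lower bound, the entrywise kernel bound.  For `n = B4.Idx Ω N` and
`ρ` = the sup-distance of ℤ^d this is `B4.Hyp56` on the nose (`hyp56_iff_B4`). GENERALISED TYPING, proved about
below — not a quotation. [cite: Balaban1983RegularityDecay, (5.6) p.594] -/
def Hyp56 (ρ : n → n → ℝ) (A : Matrix n n ℝ) (γ₀ c₀ δ₀ : ℝ) : Prop :=
  A.IsSymm ∧
  (∀ v : n → ℝ, γ₀ * ∑ p, v p ^ 2 ≤ ∑ p, v p * A.mulVec v p) ∧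
  (∀ p q : n, |A p q| ≤ c₀ * Real.exp (-(δ₀ * ρ p q)))

/-- Condition **(5.9)** of [3] p. 594 (*"|B(x,x′)| ≤ c₀e^{−δ₀(|x−x′| + dist(x,Ωᶜ) + dist(x′,Ωᶜ))}"*) with `|x − x′|`
an arbitrary pseudo-distance `ρ` and `dist(·, Ωᶜ)` an arbitrary boundary potential `ω` (in the theorem: nonnegative
and `ρ`-Lipschitz, which `dist(·, Ωᶜ)` is).  GENERALISED TYPING. [cite: Balaban1983RegularityDecay, (5.9) p.594] -/
def Hyp59 (ρ : n → n → ℝ) (ω : n → ℝ) (B : Matrix n n ℝ) (c₀ δ₀ : ℝ) : Prop :=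
  ∀ p q : n, |B p q| ≤ c₀ * Real.exp (-(δ₀ * (ρ p q + ω p + ω q)))

omit [DecidableEq n] in
/-- **(5.6) passes to every compression along an injection** `e : m → n` with the same constants: symmetry and
the kernel bound restrict; the form bound is tested on the extension by zero. [folklore] -/
theorem hyp56_submatrix {ρ : n → n → ℝ} {A : Matrix n n ℝ} {γ₀ c₀ δ₀ : ℝ} (hA : Hyp56 ρ A γ₀ c₀ δ₀)
    {m : Type*} [Fintype m] {e : m → n} (he : Function.Injective e) :
    Hyp56 (fun i j => ρ (e i) (e j)) (A.submatrix e e) γ₀ c₀ δ₀ := by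
  refine ⟨hA.1.submatrix e, fun v => ?_, fun i j => hA.2.2 (e i) (e j)⟩
  set w : n → ℝ := Function.extend e v 0 with hw
  have hwe : ∀ i, w (e i) = v i := fun i => he.extend_apply _ _ _
  have hw0 : ∀ p, (¬ ∃ i, e i = p) → w p = 0 := fun p hp => by
    rw [hw, Function.extend_apply' _ _ _ hp, Pi.zero_apply]
  have h := hA.2.1 w
  have e1 : ∑ p, w p ^ 2 = ∑ i, v i ^ 2 := by
    rw [sum_eq_sum_range he (fun p => w p ^ 2) (fun p hp => by rw [hw0 p hp]; ring)]
    simp only [hwe]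
  have e2 : ∀ p, A.mulVec w p = ∑ j, A p (e j) * v j := by
    intro p
    simp only [Matrix.mulVec, dotProduct]
    rw [sum_eq_sum_range he (fun q => A p q * w q) (fun q hq => by rw [hw0 q hq, mul_zero])]
    simp only [hwe]
  have e3 : ∑ p, w p * A.mulVec w p = ∑ i, v i * (A.submatrix e e).mulVec v i := by
    rw [sum_eq_sum_range he (fun p => w p * A.mulVec w p) (fun p hp => by rw [hw0 p hp, zero_mul])]
    apply Finset.sum_congr rfl
    intro i _
    rw [hwe, e2]
    simp [Matrix.mulVec, dotProduct, Matrix.submatrix_apply]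
  rw [← e1, ← e3]
  exact h

/-! ## §3  The constants (functions of γ₀, c₀, δ₀ and of the profile K only) -/

/-- The smallness constant `M₀ = c₀(4/δ₀)·K(δ₀/2)` of the weighted sums. [folklore] -/
noncomputable def weightC (K : ℝ → ℝ) (c₀ δ₀ : ℝ) : ℝ := c₀ * (4 / δ₀) * K (δ₀ / 2)

/-- The (5.7)-rate `δ₁ = min{δ₀/4, γ₀/(2M₀ + 1)}`. [folklore] -/
noncomputable def rate (K : ℝ → ℝ) (γ₀ c₀ δ₀ : ℝ) : ℝ :=
  min (δ₀ / 4) (γ₀ / (2 * weightC K c₀ δ₀ + 1))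

/-- The (5.8)/(5.10) constant `(2/γ₀)·c₀·(2/γ₀)·K(δ₁/2)²`. [folklore] -/
noncomputable def bigC (K : ℝ → ℝ) (γ₀ c₀ δ₀ : ℝ) : ℝ :=
  2 / γ₀ * c₀ * (2 / γ₀) * K (rate K γ₀ c₀ δ₀ / 2) * K (rate K γ₀ c₀ δ₀ / 2)

/-- The uniform constant `c₁* = max{2/γ₀, bigC}`. [folklore] -/
noncomputable def cSt (K : ℝ → ℝ) (γ₀ c₀ δ₀ : ℝ) : ℝ := max (2 / γ₀) (bigC K γ₀ c₀ δ₀)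

/-- The uniform rate `δ₁* = δ₁/4`. [folklore] -/
noncomputable def dSt (K : ℝ → ℝ) (γ₀ c₀ δ₀ : ℝ) : ℝ := rate K γ₀ c₀ δ₀ / 4

variable {K : ℝ → ℝ}

/-- `M₀ ≥ 0` for a nonnegative profile. [folklore] -/
theorem weightC_nonneg (hK : ∀ a, 0 < a → 0 ≤ K a) {c₀ δ₀ : ℝ} (hc : 0 ≤ c₀) (hδ : 0 < δ₀) :
    0 ≤ weightC K c₀ δ₀ := by
  unfold weightC
  have := hK (δ₀ / 2) (half_pos hδ)
  positivity

/-- `δ₁ > 0`. [folklore] -/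
theorem rate_pos (hK : ∀ a, 0 < a → 0 ≤ K a) {γ₀ c₀ δ₀ : ℝ} (hγ : 0 < γ₀) (hc : 0 ≤ c₀) (hδ : 0 < δ₀) :
    0 < rate K γ₀ c₀ δ₀ := by
  unfold rate
  have := weightC_nonneg hK hc hδ
  apply lt_min (by linarith)
  positivity

/-- `δ₁ ≤ δ₀/4`. [folklore] -/
theorem rate_le_quarter (K : ℝ → ℝ) (γ₀ c₀ : ℝ) {δ₀ : ℝ} : rate K γ₀ c₀ δ₀ ≤ δ₀ / 4 := min_le_left _ _

/-- `δ₁ ≤ δ₀`. [folklore] -/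
theorem rate_le_delta0 (K : ℝ → ℝ) (γ₀ c₀ : ℝ) {δ₀ : ℝ} (hδ : 0 < δ₀) : rate K γ₀ c₀ δ₀ ≤ δ₀ :=
  (min_le_left _ _).trans (by linarith)

/-- `δ₁·M₀ ≤ γ₀/2`. [folklore] -/
theorem rate_mul_weightC_le (hK : ∀ a, 0 < a → 0 ≤ K a) {γ₀ c₀ δ₀ : ℝ} (hγ : 0 < γ₀) (hc : 0 ≤ c₀) (hδ : 0 < δ₀) :
    rate K γ₀ c₀ δ₀ * weightC K c₀ δ₀ ≤ γ₀ / 2 := by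
  set M := weightC K c₀ δ₀ with hM
  have hM0 : 0 ≤ M := weightC_nonneg hK hc hδ
  have h1 : rate K γ₀ c₀ δ₀ ≤ γ₀ / (2 * M + 1) := min_le_right _ _
  calc rate K γ₀ c₀ δ₀ * M ≤ γ₀ / (2 * M + 1) * M := mul_le_mul_of_nonneg_right h1 hM0
    _ ≤ γ₀ / 2 := by
        rw [div_mul_eq_mul_div, div_le_div_iff₀ (by positivity) (by norm_num)]
        nlinarith

/-- `bigC ≥ 0`. [folklore] -/
theorem bigC_nonneg (hK : ∀ a, 0 < a → 0 ≤ K a) {γ₀ c₀ δ₀ : ℝ} (hγ : 0 < γ₀) (hc : 0 ≤ c₀) (hδ : 0 < δ₀) :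
    0 ≤ bigC K γ₀ c₀ δ₀ := by
  have h1 := hK (rate K γ₀ c₀ δ₀ / 2) (half_pos (rate_pos hK hγ hc hδ))
  unfold bigC
  positivity

/-- `c₁* > 0`. [folklore] -/
theorem cSt_pos (K : ℝ → ℝ) {γ₀ : ℝ} (c₀ δ₀ : ℝ) (hγ : 0 < γ₀) : 0 < cSt K γ₀ c₀ δ₀ :=
  lt_max_of_lt_left (by positivity)

/-- `δ₁* > 0`. [folklore] -/
theorem dSt_pos (hK : ∀ a, 0 < a → 0 ≤ K a) {γ₀ c₀ δ₀ : ℝ} (hγ : 0 < γ₀) (hc : 0 ≤ c₀) (hδ : 0 < δ₀) :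
    0 < dSt K γ₀ c₀ δ₀ := by
  unfold dSt; have := rate_pos hK hγ hc hδ; positivity

/-! ## §4  Weighted kernel sums and (5.7) by finite Combes–Thomas, uniformly in the instance -/

omit [DecidableEq n] in
/-- Weighted ROW sums: under the kernel bound of (5.6), for `0 ≤ κ ≤ δ₀/4`,
`Σ_q |A(p,q)|(e^{κρ(p,q)} − 1) ≤ κ·M₀`, uniformly in the instance. [folklore] -/
theorem weightedRowSum_le {ρ : n → n → ℝ} (hρ0 : ∀ p q, 0 ≤ ρ p q) (hS : SumBound ρ K)
    (A : Matrix n n ℝ) {c₀ δ₀ κ : ℝ} (hc : 0 ≤ c₀) (hδ : 0 < δ₀) (hκ0 : 0 ≤ κ) (hκ : κ ≤ δ₀ / 4)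
    (hA : ∀ p q : n, |A p q| ≤ c₀ * Real.exp (-(δ₀ * ρ p q))) (p : n) :
    ∑ q, |A p q| * (Real.exp (κ * ρ p q) - 1) ≤ κ * weightC K c₀ δ₀ := by
  have step : ∀ q : n, |A p q| * (Real.exp (κ * ρ p q) - 1) ≤
      c₀ * (κ * (4 / δ₀)) * Real.exp (-(δ₀ / 2 * ρ p q)) := by
    intro q
    have hn0 : 0 ≤ ρ p q := hρ0 p q
    have hw : 0 ≤ Real.exp (κ * ρ p q) - 1 := by
      have : (1 : ℝ) ≤ Real.exp (κ * ρ p q) := Real.one_le_exp (mul_nonneg hκ0 hn0)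
      linarith
    calc |A p q| * (Real.exp (κ * ρ p q) - 1)
        ≤ c₀ * Real.exp (-(δ₀ * ρ p q)) * (Real.exp (κ * ρ p q) - 1) :=
          mul_le_mul_of_nonneg_right (hA p q) hw
      _ = c₀ * (Real.exp (-(δ₀ * ρ p q)) * (Real.exp (κ * ρ p q) - 1)) := by ring
      _ ≤ c₀ * (κ * (4 / δ₀) * Real.exp (-(δ₀ / 2 * ρ p q))) :=
          mul_le_mul_of_nonneg_left (B4Sect5Proof.exp_weight_le hδ hκ0 hκ hn0) hc
      _ = c₀ * (κ * (4 / δ₀)) * Real.exp (-(δ₀ / 2 * ρ p q)) := by ring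
  calc ∑ q, |A p q| * (Real.exp (κ * ρ p q) - 1)
      ≤ ∑ q, c₀ * (κ * (4 / δ₀)) * Real.exp (-(δ₀ / 2 * ρ p q)) := Finset.sum_le_sum fun q _ => step q
    _ = c₀ * (κ * (4 / δ₀)) * ∑ q, Real.exp (-(δ₀ / 2 * ρ p q)) := by rw [Finset.mul_sum]
    _ ≤ c₀ * (κ * (4 / δ₀)) * K (δ₀ / 2) := by
        apply mul_le_mul_of_nonneg_left (hS (δ₀ / 2) (half_pos hδ) p)
        exact mul_nonneg hc (mul_nonneg hκ0 (div_nonneg (by norm_num) hδ.le))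
    _ = κ * weightC K c₀ δ₀ := by unfold weightC; ring

omit [DecidableEq n] in
/-- Weighted COLUMN sums, by the symmetry of the pseudo-distance. [folklore] -/
theorem weightedColSum_le {ρ : n → n → ℝ} (hρ : IsPseudoDist ρ) (hS : SumBound ρ K)
    (A : Matrix n n ℝ) {c₀ δ₀ κ : ℝ} (hc : 0 ≤ c₀) (hδ : 0 < δ₀) (hκ0 : 0 ≤ κ) (hκ : κ ≤ δ₀ / 4)
    (hA : ∀ p q : n, |A p q| ≤ c₀ * Real.exp (-(δ₀ * ρ p q))) (q : n) :
    ∑ p, |A p q| * (Real.exp (κ * ρ p q) - 1) ≤ κ * weightC K c₀ δ₀ := by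
  have hAt : ∀ p q : n, |A.transpose p q| ≤ c₀ * Real.exp (-(δ₀ * ρ p q)) := by
    intro p q
    rw [Matrix.transpose_apply, hρ.symm]
    exact hA q p
  have h := weightedRowSum_le hρ.nonneg hS A.transpose hc hδ hκ0 hκ hAt q
  simp only [Matrix.transpose_apply] at h
  calc ∑ p, |A p q| * (Real.exp (κ * ρ p q) - 1)
      = ∑ p, |A p q| * (Real.exp (κ * ρ q p) - 1) := by
        apply Finset.sum_congr rfl; intro p _; rw [hρ.symm]
    _ ≤ κ * weightC K c₀ δ₀ := h

omit [DecidableEq n] in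
/-- `Hyp56`'s quadratic-form conjunct is `QGQInverse.Coercive`. [folklore] -/
theorem coercive_of_hyp56 {ρ : n → n → ℝ} {A : Matrix n n ℝ} {γ₀ c₀ δ₀ : ℝ} (hA : Hyp56 ρ A γ₀ c₀ δ₀) :
    QGQInverse.Coercive A γ₀ := by
  intro x
  have h := hA.2.1 x
  have e1 : x ⬝ᵥ x = ∑ p, x p ^ 2 := by simp [dotProduct, pow_two]
  have e2 : x ⬝ᵥ (A *ᵥ x) = ∑ p, x p * A.mulVec x p := rfl
  rw [e1, e2]; exact h

/-- A kernel with (5.6) is invertible (coercivity). [folklore] -/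
theorem isUnit_of_hyp56 {ρ : n → n → ℝ} {A : Matrix n n ℝ} {γ₀ c₀ δ₀ : ℝ} (hγ : 0 < γ₀)
    (hA : Hyp56 ρ A γ₀ c₀ δ₀) : IsUnit A :=
  QGQInverse.isUnit_of_coercive hγ (coercive_of_hyp56 hA)

/-- **(5.7) for `A` itself, uniformly in the instance**: under (5.6) and the profile bound,
`|A⁻¹(x,x′)| ≤ (2/γ₀)e^{−δ₁ρ(x,x′)}`, `δ₁ = rate K γ₀ c₀ δ₀`.  Finite Combes–Thomas (`QGQInverse.inverse_decay`)
with the weighted sums of this section (`ρ_CT = δ₁M₀ ≤ γ₀/2`). [folklore] -/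
theorem inv_decay (hK : ∀ a, 0 < a → 0 ≤ K a) {γ₀ c₀ δ₀ : ℝ} (hγ : 0 < γ₀) (hc : 0 ≤ c₀) (hδ : 0 < δ₀)
    {ρ : n → n → ℝ} (hρ : IsPseudoDist ρ) (hS : SumBound ρ K)
    {A : Matrix n n ℝ} (hA : Hyp56 ρ A γ₀ c₀ δ₀) (p q : n) :
    |A⁻¹ p q| ≤ 2 / γ₀ * Real.exp (-(rate K γ₀ c₀ δ₀ * ρ p q)) := by
  set δ₁ := rate K γ₀ c₀ δ₀ with hδ₁
  set r := δ₁ * weightC K c₀ δ₀ with hr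
  have hδ₁0 : 0 ≤ δ₁ := (rate_pos hK hγ hc hδ).le
  have hδ₁4 : δ₁ ≤ δ₀ / 4 := rate_le_quarter K γ₀ c₀
  have hrle : r ≤ γ₀ / 2 := rate_mul_weightC_le hK hγ hc hδ
  have hrγ : r < γ₀ := by linarith
  have h := QGQInverse.inverse_decay A ρ hrγ hδ₁0 (coercive_of_hyp56 hA) hρ.symm hρ.zero hρ.triangle
    (fun i => weightedRowSum_le hρ.nonneg hS A hc hδ hδ₁0 hδ₁4 hA.2.2 i)
    (fun j => weightedColSum_le hρ hS A hc hδ hδ₁0 hδ₁4 hA.2.2 j) p q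
  refine h.trans ?_
  apply mul_le_mul_of_nonneg_right _ (Real.exp_pos _).le
  rw [div_eq_mul_inv, show (2 : ℝ) * γ₀⁻¹ = (γ₀ / 2)⁻¹ by rw [inv_div]; ring]
  exact inv_anti₀ (by linarith) (by linarith)

omit [DecidableEq n] in
/-- **(5.7) for every compression `A_Λ = A.submatrix e e` along an injection, with the SAME constants**
((5.6) and the profile bound pass to the range of `e`). [folklore] -/
theorem inv_submatrix_decay (hK : ∀ a, 0 < a → 0 ≤ K a) {γ₀ c₀ δ₀ : ℝ} (hγ : 0 < γ₀) (hc : 0 ≤ c₀) (hδ : 0 < δ₀)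
    {ρ : n → n → ℝ} (hρ : IsPseudoDist ρ) (hS : SumBound ρ K)
    {A : Matrix n n ℝ} (hA : Hyp56 ρ A γ₀ c₀ δ₀)
    {m : Type*} [Fintype m] [DecidableEq m] {e : m → n} (he : Function.Injective e) (i j : m) :
    |(A.submatrix e e)⁻¹ i j| ≤ 2 / γ₀ * Real.exp (-(rate K γ₀ c₀ δ₀ * ρ (e i) (e j))) :=
  inv_decay hK hγ hc hδ (hρ.comp e) (hS.comp he) (hyp56_submatrix hA he) i j

/-! ## §5  (5.8): the block identity `A_Λ⁻¹ − A⁻¹|_Λ = A_Λ⁻¹ · (ΛAΛᶜ) · A⁻¹|_{Λᶜ×Λ}` along an injection, and its decay -/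

section Blocks

variable {m : Type*} [Fintype m] [DecidableEq m]

/-- The off-block `Λ A Λᶜ` of a kernel `A` on `n` along `e : m → n` (Λ = range e): rows indexed by `m`, columns
by `n`, zero on the columns in the range — the operator through which `A_Λ⁻¹` and `A⁻¹` communicate in the resolvent
identity behind (5.8). [cite: Balaban1983RegularityDecay, (5.8) p.594] -/
def offBlock (e : m → n) (A : Matrix n n ℝ) : Matrix m n ℝ :=
  Matrix.of fun r s => if ∃ i, e i = s then 0 else A (e r) s

omit [Fintype n] [DecidableEq m] in
/-- Entry formula of the off-block. [folklore] -/
@[simp] theorem offBlock_apply (e : m → n) (A : Matrix n n ℝ) (r : m) (s : n) :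
    offBlock e A r s = if ∃ i, e i = s then 0 else A (e r) s := rfl

omit [DecidableEq m] in
/-- Splitting a sum over `n` into the range of the injection `e` and its complement. [folklore] -/
theorem sum_split {e : m → n} (he : Function.Injective e) (f : n → ℝ) :
    ∑ s, f s = ∑ j, f (e j) + ∑ s, (if ∃ i, e i = s then 0 else f s) := by
  have h1 : ∑ j, f (e j) = ∑ s, (if ∃ i, e i = s then f s else 0) := by
    rw [sum_eq_sum_range he (fun s => if ∃ i, e i = s then f s else 0)
      (fun s hs => by rw [if_neg hs])]
    apply Finset.sum_congr rfl
    intro j _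
    rw [if_pos ⟨j, rfl⟩]
  rw [h1, ← Finset.sum_add_distrib]
  apply Finset.sum_congr rfl
  intro s _
  split_ifs <;> simp

omit [DecidableEq m] in
/-- Splitting `Σ_{s∈n} A(e r, s)C(s, e q)` into the range and its complement:
`A_Λ·C_Λ + (ΛAΛᶜ)·(C|_{n×Λ}) = (AC)_Λ`. [folklore] -/
theorem submatrix_mul_add_offBlock_mul {e : m → n} (he : Function.Injective e) (A C : Matrix n n ℝ) :
    A.submatrix e e * C.submatrix e e + offBlock e A * C.submatrix id e = (A * C).submatrix e e := by
  ext r q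
  simp only [Matrix.add_apply, Matrix.mul_apply, Matrix.submatrix_apply, offBlock_apply, id]
  rw [sum_split he (fun s => A (e r) s * C s (e q))]
  congr 1
  apply Finset.sum_congr rfl
  intro s _
  split_ifs <;> simp

/-- **The resolvent (Schur-block) identity behind (5.8)** along an injection: for invertible `A` with invertible
compression `A_Λ = A.submatrix e e`, `A_Λ⁻¹ − A⁻¹|_Λ = A_Λ⁻¹ · (ΛAΛᶜ) · (A⁻¹|_{n×Λ})`.  (The paper's route to (5.8)
is the random-walk expansion (5.24)–(5.27); exact block algebra replaces it, as in `B4Sect5Proof.deltaC_eq`.)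
[cite: Balaban1983RegularityDecay, (5.8) p.594] -/
theorem deltaC_eq {e : m → n} (he : Function.Injective e) {A : Matrix n n ℝ}
    (hA : IsUnit A) (hAe : IsUnit (A.submatrix e e)) :
    (A.submatrix e e)⁻¹ - (A⁻¹).submatrix e e =
      (A.submatrix e e)⁻¹ * offBlock e A * (A⁻¹).submatrix id e := by
  have hdet : IsUnit A.det := (Matrix.isUnit_iff_isUnit_det A).mp hA
  have hdete : IsUnit (A.submatrix e e).det := (Matrix.isUnit_iff_isUnit_det _).mp hAe
  have key := submatrix_mul_add_offBlock_mul he A A⁻¹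
  rw [Matrix.mul_nonsing_inv A hdet, Matrix.submatrix_one e he] at key
  have k2 := congrArg (fun X => (A.submatrix e e)⁻¹ * X) key
  simp only [Matrix.mul_add, ← Matrix.mul_assoc, Matrix.nonsing_inv_mul _ hdete, Matrix.one_mul,
    Matrix.mul_one] at k2
  exact sub_eq_of_eq_add' k2.symm

/-- **(5.8), uniformly in the instance and in the compression**: under (5.6) and the profile bound, for every
injection `e : m → n` and every nonnegative `β` on `m` dominated by the distances to the complement of the range
(`β i ≤ ρ(e i, z)`, `z ∉ range e` — e.g. `β = dist(·, Λᶜ)`),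
`|A_Λ⁻¹(i,j) − A⁻¹(e i, e j)| ≤ bigC·e^{−(δ₁/4)(ρ(e i,e j) + β i + β j)}`.  Mechanism: `deltaC_eq`; the middle
factor lives on columns off the range, so every term of the double sum passes through a point `z ∉ Λ` (path length
`≥ β i + β j` and `≥ ρ(e i, e j)`); the outer factors decay by (5.7); the two free sums are bounded by the profile.
[cite: Balaban1983RegularityDecay, (5.8) p.594] -/
theorem deltaC_bound (hK : ∀ a, 0 < a → 0 ≤ K a) {γ₀ c₀ δ₀ : ℝ} (hγ : 0 < γ₀) (hc : 0 < c₀) (hδ : 0 < δ₀)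
    {ρ : n → n → ℝ} (hρ : IsPseudoDist ρ) (hS : SumBound ρ K)
    {A : Matrix n n ℝ} (hA : Hyp56 ρ A γ₀ c₀ δ₀)
    {e : m → n} (he : Function.Injective e) {β : m → ℝ} (hβ0 : ∀ i, 0 ≤ β i)
    (hβ : ∀ i z, (¬ ∃ j, e j = z) → β i ≤ ρ (e i) z) (p q : m) :
    |(A.submatrix e e)⁻¹ p q - A⁻¹ (e p) (e q)| ≤
      bigC K γ₀ c₀ δ₀ * Real.exp (-(rate K γ₀ c₀ δ₀ / 4 * (ρ (e p) (e q) + β p + β q))) := by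
  set δ₁ := rate K γ₀ c₀ δ₀ with hδ₁
  set c₁ : ℝ := 2 / γ₀ with hc₁
  set K₁ : ℝ := K (δ₁ / 2) with hK₁
  set T := ρ (e p) (e q) + β p + β q with hT
  have hδ₁pos : 0 < δ₁ := rate_pos hK hγ hc.le hδ
  have hδ₁0 : 0 ≤ δ₁ := hδ₁pos.le
  have hδ₁δ₀ : δ₁ ≤ δ₀ := rate_le_delta0 K γ₀ c₀ hδ
  have hc₁0 : 0 ≤ c₁ := by rw [hc₁]; positivity
  have hAe : Hyp56 (fun i j => ρ (e i) (e j)) (A.submatrix e e) γ₀ c₀ δ₀ := hyp56_submatrix hA he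
  -- the entry is a triple product
  have entry : (A.submatrix e e)⁻¹ p q - A⁻¹ (e p) (e q) =
      ((A.submatrix e e)⁻¹ * offBlock e A * (A⁻¹).submatrix id e) p q := by
    have h1 := deltaC_eq he (isUnit_of_hyp56 hγ hA) (isUnit_of_hyp56 hγ hAe)
    have h2 := congrFun (congrFun h1 p) q
    rw [Matrix.sub_apply, Matrix.submatrix_apply] at h2
    exact h2
  rw [entry]
  refine (B4Sect5Proof.abs_mul3_apply_le _ _ _ p q).trans ?_
  set W := c₁ * c₀ * c₁ * Real.exp (-(δ₁ / 4 * T)) with hW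
  have hW0 : 0 ≤ W := by rw [hW]; positivity
  have main := B4Sect5Proof.sum_sum_le_of_factor
    (fun (r : m) (s : n) => |(A.submatrix e e)⁻¹ p r| * |offBlock e A r s| * |(A⁻¹).submatrix id e s q|)
    (fun r : m => Real.exp (-(δ₁ / 2 * ρ (e p) (e r))))
    (fun s : n => Real.exp (-(δ₁ / 2 * ρ (e q) s)))
    (W := W) (Ka := K₁) (Kb := K₁) hW0 (fun r => (Real.exp_pos _).le) (fun s => (Real.exp_pos _).le)
    ?_ ((hS.comp he) (δ₁ / 2) (half_pos hδ₁pos) p) (hS (δ₁ / 2) (half_pos hδ₁pos) (e q))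
  · refine main.trans (le_of_eq ?_)
    rw [hW]; unfold bigC; rw [← hδ₁, ← hK₁]; ring
  -- pointwise factorised majorant
  intro r s
  by_cases hs : ∃ i, e i = s
  · have h0 : offBlock e A r s = 0 := by rw [offBlock_apply, if_pos hs]
    rw [h0, abs_zero, mul_zero, zero_mul]
    positivity
  · have hX := inv_submatrix_decay hK hγ hc.le hδ hρ hS hA he p r
    have hM : |offBlock e A r s| ≤ c₀ * Real.exp (-(δ₀ * ρ (e r) s)) := by
      rw [offBlock_apply, if_neg hs]
      exact hA.2.2 (e r) s
    have hY : |(A⁻¹).submatrix id e s q| ≤ c₁ * Real.exp (-(δ₁ * ρ s (e q))) := by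
      rw [Matrix.submatrix_apply]
      exact inv_decay hK hγ hc.le hδ hρ hS hA s (e q)
    set D₁ := ρ (e p) (e r) with hD₁
    set D₂ := ρ (e r) s with hD₂
    set D₃ := ρ s (e q) with hD₃
    have hip : β p ≤ ρ (e p) s := hβ p s hs
    have hiq : β q ≤ ρ (e q) s := hβ q s hs
    have t1 : ρ (e p) s ≤ D₁ + D₂ := hρ.triangle _ _ _
    have t2 : ρ (e p) (e q) ≤ D₁ + D₂ + D₃ := by
      have := hρ.triangle (e p) s (e q)
      linarith
    have t3 : ρ (e q) s = D₃ := hρ.symm _ _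
    have hD₂0 : 0 ≤ D₂ := hρ.nonneg _ _
    have hTle : T ≤ 2 * (D₁ + D₂ + D₃) := by
      rw [hT]
      have := hβ0 p
      have := hβ0 q
      linarith
    have hsplit := B4Sect5Proof.exp_split hδ₁0 hδ₁δ₀ hD₂0 hTle
    calc |(A.submatrix e e)⁻¹ p r| * |offBlock e A r s| * |(A⁻¹).submatrix id e s q|
        ≤ c₁ * Real.exp (-(δ₁ * D₁)) * (c₀ * Real.exp (-(δ₀ * D₂))) * (c₁ * Real.exp (-(δ₁ * D₃))) := by
          apply mul_le_mul (mul_le_mul hX hM (abs_nonneg _) (by positivity)) hY (abs_nonneg _)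
          positivity
      _ = c₁ * c₀ * c₁ * (Real.exp (-(δ₁ * D₁)) * Real.exp (-(δ₀ * D₂)) * Real.exp (-(δ₁ * D₃))) := by
          ring
      _ ≤ c₁ * c₀ * c₁ *
          (Real.exp (-(δ₁ / 4 * T)) * Real.exp (-(δ₁ / 2 * D₁)) * Real.exp (-(δ₁ / 2 * D₃))) :=
          mul_le_mul_of_nonneg_left hsplit (by positivity)
      _ = W * Real.exp (-(δ₁ / 2 * D₁)) * Real.exp (-(δ₁ / 2 * ρ (e q) s)) := by
          rw [t3, hW]; ring

/-! ## §6  (5.10): the second resolvent identity `A_Λ⁻¹ − (A+B)_Λ⁻¹ = A_Λ⁻¹ B_Λ (A+B)_Λ⁻¹` and its decay -/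

omit [DecidableEq n] in
/-- **(5.10), uniformly in the instance and in the compression**: under (5.6) for `A` and `A + B`, (5.9) for `B`
with a nonnegative `ρ`-Lipschitz boundary potential `ω` (`ω x ≤ ρ(x,y) + ω y` — e.g. `ω = dist(·, Ωᶜ)`), for every
injection `e`, `|A_Λ⁻¹(i,j) − (A+B)_Λ⁻¹(i,j)| ≤ bigC·e^{−(δ₁/4)(ρ(e i,e j) + ω(e i) + ω(e j))}`.  Mechanism: the second
resolvent identity (`B4Sect5Proof.inv_sub_inv_eq`, the p. 597 difference taken exactly rather than through (5.24)),
(5.9) for the middle factor, the Lipschitz property of `ω`, (5.7) for the outer factors, the profile bound.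
[cite: Balaban1983RegularityDecay, (5.10) p.594] -/
theorem perturb_bound (hK : ∀ a, 0 < a → 0 ≤ K a) {γ₀ c₀ δ₀ : ℝ} (hγ : 0 < γ₀) (hc : 0 < c₀) (hδ : 0 < δ₀)
    {ρ : n → n → ℝ} (hρ : IsPseudoDist ρ) (hS : SumBound ρ K)
    {A B : Matrix n n ℝ} (hA : Hyp56 ρ A γ₀ c₀ δ₀) (hAB : Hyp56 ρ (A + B) γ₀ c₀ δ₀)
    {ω : n → ℝ} (hω0 : ∀ x, 0 ≤ ω x) (hω : ∀ x y, ω x ≤ ρ x y + ω y) (hB : Hyp59 ρ ω B c₀ δ₀)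
    {e : m → n} (he : Function.Injective e) (p q : m) :
    |(A.submatrix e e)⁻¹ p q - ((A + B).submatrix e e)⁻¹ p q| ≤
      bigC K γ₀ c₀ δ₀ * Real.exp (-(rate K γ₀ c₀ δ₀ / 4 * (ρ (e p) (e q) + ω (e p) + ω (e q)))) := by
  set δ₁ := rate K γ₀ c₀ δ₀ with hδ₁
  set c₁ : ℝ := 2 / γ₀ with hc₁
  set K₁ : ℝ := K (δ₁ / 2) with hK₁
  set T := ρ (e p) (e q) + ω (e p) + ω (e q) with hT
  have hδ₁pos : 0 < δ₁ := rate_pos hK hγ hc.le hδ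
  have hδ₁0 : 0 ≤ δ₁ := hδ₁pos.le
  have hδ₁δ₀ : δ₁ ≤ δ₀ := rate_le_delta0 K γ₀ c₀ hδ
  have hc₁0 : 0 ≤ c₁ := by rw [hc₁]; positivity
  have hAe : Hyp56 (fun i j => ρ (e i) (e j)) (A.submatrix e e) γ₀ c₀ δ₀ := hyp56_submatrix hA he
  have hABe : Hyp56 (fun i j => ρ (e i) (e j)) ((A + B).submatrix e e) γ₀ c₀ δ₀ := hyp56_submatrix hAB he
  have hsub : (A + B).submatrix e e - A.submatrix e e = B.submatrix e e := by
    ext r s; simp [Matrix.submatrix_apply]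
  have entry : (A.submatrix e e)⁻¹ p q - ((A + B).submatrix e e)⁻¹ p q =
      ((A.submatrix e e)⁻¹ * B.submatrix e e * ((A + B).submatrix e e)⁻¹) p q := by
    have h1 := B4Sect5Proof.inv_sub_inv_eq (isUnit_of_hyp56 hγ hAe) (isUnit_of_hyp56 hγ hABe)
    rw [hsub] at h1
    have h2 := congrFun (congrFun h1 p) q
    rw [Matrix.sub_apply] at h2
    exact h2
  rw [entry]
  refine (B4Sect5Proof.abs_mul3_apply_le _ _ _ p q).trans ?_
  set W := c₁ * c₀ * c₁ * Real.exp (-(δ₁ / 4 * T)) with hW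
  have hW0 : 0 ≤ W := by rw [hW]; positivity
  have main := B4Sect5Proof.sum_sum_le_of_factor
    (fun (r : m) (s : m) =>
      |(A.submatrix e e)⁻¹ p r| * |B.submatrix e e r s| * |((A + B).submatrix e e)⁻¹ s q|)
    (fun r : m => Real.exp (-(δ₁ / 2 * ρ (e p) (e r))))
    (fun s : m => Real.exp (-(δ₁ / 2 * ρ (e q) (e s))))
    (W := W) (Ka := K₁) (Kb := K₁) hW0 (fun r => (Real.exp_pos _).le) (fun s => (Real.exp_pos _).le)
    ?_ ((hS.comp he) (δ₁ / 2) (half_pos hδ₁pos) p) ((hS.comp he) (δ₁ / 2) (half_pos hδ₁pos) q)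
  · refine main.trans (le_of_eq ?_)
    rw [hW]; unfold bigC; rw [← hδ₁, ← hK₁]; ring
  intro r s
  have hX := inv_submatrix_decay hK hγ hc.le hδ hρ hS hA he p r
  have hM : |B.submatrix e e r s| ≤
      c₀ * Real.exp (-(δ₀ * (ρ (e r) (e s) + ω (e r) + ω (e s)))) := by
    rw [Matrix.submatrix_apply]
    exact hB (e r) (e s)
  have hY := inv_submatrix_decay hK hγ hc.le hδ hρ hS hAB he s q
  set D₁ := ρ (e p) (e r) with hD₁
  set D₃ := ρ (e s) (e q) with hD₃
  set ur := ω (e r) with hur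
  set us := ω (e s) with hus
  set D₂ := ρ (e r) (e s) + ur + us with hD₂
  have hur0 : 0 ≤ ur := hω0 _
  have hus0 : 0 ≤ us := hω0 _
  have hrs0 : 0 ≤ ρ (e r) (e s) := hρ.nonneg _ _
  have hD₂0 : 0 ≤ D₂ := by rw [hD₂]; positivity
  have hip : ω (e p) ≤ D₁ + ur := by rw [hD₁, hur]; exact hω _ _
  have hiq : ω (e q) ≤ ρ (e q) (e s) + us := by rw [hus]; exact hω _ _
  have t2 : ρ (e p) (e q) ≤ D₁ + ρ (e r) (e s) + D₃ := by
    have := hρ.triangle (e p) (e r) (e q)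
    have := hρ.triangle (e r) (e s) (e q)
    linarith
  have t3 : ρ (e q) (e s) = D₃ := hρ.symm _ _
  have hTle : T ≤ 2 * (D₁ + D₂ + D₃) := by rw [hT, hD₂]; linarith
  have hsplit := B4Sect5Proof.exp_split hδ₁0 hδ₁δ₀ hD₂0 hTle
  calc |(A.submatrix e e)⁻¹ p r| * |B.submatrix e e r s| * |((A + B).submatrix e e)⁻¹ s q|
      ≤ c₁ * Real.exp (-(δ₁ * D₁)) * (c₀ * Real.exp (-(δ₀ * D₂))) * (c₁ * Real.exp (-(δ₁ * D₃))) := by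
        apply mul_le_mul (mul_le_mul hX hM (abs_nonneg _) (by positivity)) hY (abs_nonneg _)
        positivity
    _ = c₁ * c₀ * c₁ * (Real.exp (-(δ₁ * D₁)) * Real.exp (-(δ₀ * D₂)) * Real.exp (-(δ₁ * D₃))) := by
        ring
    _ ≤ c₁ * c₀ * c₁ *
        (Real.exp (-(δ₁ / 4 * T)) * Real.exp (-(δ₁ / 2 * D₁)) * Real.exp (-(δ₁ / 2 * D₃))) :=
        mul_le_mul_of_nonneg_left hsplit (by positivity)
    _ = W * Real.exp (-(δ₁ / 2 * D₁)) * Real.exp (-(δ₁ / 2 * ρ (e q) (e s))) := by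
        rw [t3, hW]; ring

/-! ## §7  The Sect. 5 Theorem over an arbitrary finite index set, with explicit uniform constants -/

/-- **The Sect. 5 Theorem of [3], generalised and kernel-proved, explicit form**: for `(γ₀, c₀, δ₀)` and a
nonnegative profile `K`, the pair `(cSt K γ₀ c₀ δ₀, dSt K γ₀ c₀ δ₀)` serves (5.7), (5.8) and (5.10) for EVERY finite
index set with a pseudo-distance obeying the profile bound, every `A` with (5.6), every compression along an
injection, every admissible boundary potential and perturbation.  For ℤ^d and for the torus see §10, §9.
[cite: Balaban1983RegularityDecay, Sect. 5 Theorem (5.6)–(5.10) p.594 + p.597] -/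
theorem sect5_uniform (hK : ∀ a, 0 < a → 0 ≤ K a) {γ₀ c₀ δ₀ : ℝ} (hγ : 0 < γ₀) (hc : 0 < c₀) (hδ : 0 < δ₀)
    {ρ : n → n → ℝ} (hρ : IsPseudoDist ρ) (hS : SumBound ρ K)
    {A : Matrix n n ℝ} (hA : Hyp56 ρ A γ₀ c₀ δ₀) {e : m → n} (he : Function.Injective e) :
    (∀ i j : m, |(A.submatrix e e)⁻¹ i j| ≤
        cSt K γ₀ c₀ δ₀ * Real.exp (-(dSt K γ₀ c₀ δ₀ * ρ (e i) (e j)))) ∧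
    (∀ β : m → ℝ, (∀ i, 0 ≤ β i) → (∀ i z, (¬ ∃ j, e j = z) → β i ≤ ρ (e i) z) →
      ∀ i j : m, |(A.submatrix e e)⁻¹ i j - A⁻¹ (e i) (e j)| ≤
        cSt K γ₀ c₀ δ₀ * Real.exp (-(dSt K γ₀ c₀ δ₀ * (ρ (e i) (e j) + β i + β j)))) ∧
    (∀ (B : Matrix n n ℝ) (ω : n → ℝ), Hyp56 ρ (A + B) γ₀ c₀ δ₀ → (∀ x, 0 ≤ ω x) →
      (∀ x y, ω x ≤ ρ x y + ω y) → Hyp59 ρ ω B c₀ δ₀ →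
      ∀ i j : m, |(A.submatrix e e)⁻¹ i j - ((A + B).submatrix e e)⁻¹ i j| ≤
        cSt K γ₀ c₀ δ₀ * Real.exp (-(dSt K γ₀ c₀ δ₀ * (ρ (e i) (e j) + ω (e i) + ω (e j))))) := by
  have h2γ : (0 : ℝ) ≤ 2 / γ₀ := by positivity
  have hbig := bigC_nonneg hK hγ hc.le hδ
  have hrate1 : dSt K γ₀ c₀ δ₀ ≤ rate K γ₀ c₀ δ₀ := by
    unfold dSt; have := rate_pos hK hγ hc.le hδ; linarith
  have hrate2 : dSt K γ₀ c₀ δ₀ ≤ rate K γ₀ c₀ δ₀ / 4 := le_rfl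
  refine ⟨fun i j => ?_, fun β hβ0 hβ i j => ?_, fun B ω hAB hω0 hω hB i j => ?_⟩
  · exact (inv_submatrix_decay hK hγ hc.le hδ hρ hS hA he i j).trans
      (B4Sect5Proof.weaken h2γ (le_max_left _ _) hrate1 (hρ.nonneg _ _))
  · refine (deltaC_bound hK hγ hc hδ hρ hS hA he hβ0 hβ i j).trans
      (B4Sect5Proof.weaken hbig (le_max_right _ _) hrate2 ?_)
    have := hρ.nonneg (e i) (e j); have := hβ0 i; have := hβ0 j
    linarith
  · refine (perturb_bound hK hγ hc hδ hρ hS hA hAB hω0 hω hB he i j).trans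
      (B4Sect5Proof.weaken hbig (le_max_right _ _) hrate2 ?_)
    have := hρ.nonneg (e i) (e j); have := hω0 (e i); have := hω0 (e j)
    linarith

end Blocks

end Abstract

/-- **The Sect. 5 Theorem over finite index sets, packaged with the printed quantifier order** (∃ (c₁, δ₁) BEFORE
the instance), for a profile `K`: for all positive `γ₀, c₀, δ₀` THERE ARE positive `c₁, δ₁` such that
for every finite index set `n` with a pseudo-distance `ρ` obeying `Σ_y e^{−aρ(x,y)} ≤ K(a)`, every `A` with (5.6),
every compression along an injection `e : m → n`: (5.7), (5.8) (for every admissible `β`) and, for every admissible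
`(B, ω)` with (5.6) for `A + B` and (5.9), (5.10). [cite: Balaban1983RegularityDecay, Sect. 5 Theorem p.594 + p.597] -/
def Sect5Uniform (K : ℝ → ℝ) : Prop :=
  ∀ γ₀ c₀ δ₀ : ℝ, 0 < γ₀ → 0 < c₀ → 0 < δ₀ → ∃ c₁ δ₁ : ℝ, 0 < c₁ ∧ 0 < δ₁ ∧
    ∀ (n : Type) [Fintype n] [DecidableEq n] (ρ : n → n → ℝ), IsPseudoDist ρ → SumBound ρ K →
    ∀ A : Matrix n n ℝ, Hyp56 ρ A γ₀ c₀ δ₀ →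
    ∀ (m : Type) [Fintype m] [DecidableEq m] (e : m → n), Function.Injective e →
      (∀ i j : m, |(A.submatrix e e)⁻¹ i j| ≤ c₁ * Real.exp (-(δ₁ * ρ (e i) (e j)))) ∧
      (∀ β : m → ℝ, (∀ i, 0 ≤ β i) → (∀ i z, (¬ ∃ j, e j = z) → β i ≤ ρ (e i) z) →
        ∀ i j : m, |(A.submatrix e e)⁻¹ i j - A⁻¹ (e i) (e j)| ≤
          c₁ * Real.exp (-(δ₁ * (ρ (e i) (e j) + β i + β j)))) ∧
      (∀ (B : Matrix n n ℝ) (ω : n → ℝ), Hyp56 ρ (A + B) γ₀ c₀ δ₀ → (∀ x, 0 ≤ ω x) →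
        (∀ x y, ω x ≤ ρ x y + ω y) → Hyp59 ρ ω B c₀ δ₀ →
        ∀ i j : m, |(A.submatrix e e)⁻¹ i j - ((A + B).submatrix e e)⁻¹ i j| ≤
          c₁ * Real.exp (-(δ₁ * (ρ (e i) (e j) + ω (e i) + ω (e j)))))

/-- **THE GENERALISED SECT. 5 THEOREM IS A THEOREM**, for every profile nonnegative on positive rates. [cite: Balaban1983RegularityDecay, Sect. 5 Theorem p.594 + p.597] -/
theorem sect5Uniform_holds (K : ℝ → ℝ) (hK : ∀ a, 0 < a → 0 ≤ K a) : Sect5Uniform K := by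
  intro γ₀ c₀ δ₀ hγ hc hδ
  refine ⟨cSt K γ₀ c₀ δ₀, dSt K γ₀ c₀ δ₀, cSt_pos K c₀ δ₀ hγ, dSt_pos hK hγ hc.le hδ, ?_⟩
  intro n _ _ ρ hρ hS A hA m _ _ e he
  exact sect5_uniform hK hγ hc hδ hρ hS hA he

/-! ## §8  The discrete torus `Π_i ℤ/P_iℤ`: sites, the sup-circular distance, uniform lattice sums -/

section Torus

open B4TorusKernel.MultiPeriod

/-- `dist(0, Nℤ) = 0`. [folklore] -/
theorem circAbs_zero (N : ℕ) : circAbs N 0 = 0 := by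
  unfold circAbs
  simp

/-- `dist(−z, Nℤ) ≤ dist(z, Nℤ)` (periodicity + the centred representative). [folklore] -/
theorem circAbs_neg_le {N : ℕ} (hN : 1 ≤ N) (z : ℤ) : circAbs N (-z) ≤ circAbs N z := by
  have h1 : circAbs N (-z) = circAbs N (-z + N * (-centre N z)) :=
    (circAbs_add_mul N (-z) (-centre N z)).symm
  rw [h1]
  calc circAbs N (-z + N * -centre N z) ≤ |-z + N * -centre N z| := circAbs_le_abs hN _
    _ = |z + N * centre N z| := by
        rw [show -z + (N : ℤ) * -centre N z = -(z + N * centre N z) by ring, abs_neg]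
    _ = circAbs N z := abs_add_mul_centre hN z

/-- The circular distance is symmetric: `dist(−z, Nℤ) = dist(z, Nℤ)`. [folklore] -/
theorem circAbs_neg {N : ℕ} (hN : 1 ≤ N) (z : ℤ) : circAbs N (-z) = circAbs N z :=
  le_antisymm (circAbs_neg_le hN z) (by simpa using circAbs_neg_le hN (-z))

/-- The circular distance is subadditive: `dist(a + b, Nℤ) ≤ dist(a, Nℤ) + dist(b, Nℤ)`. [folklore] -/
theorem circAbs_add_le {N : ℕ} (hN : 1 ≤ N) (a b : ℤ) :
    circAbs N (a + b) ≤ circAbs N a + circAbs N b := by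
  have h1 : circAbs N (a + b) = circAbs N ((a + N * centre N a) + (b + N * centre N b)) := by
    rw [show (a + N * centre N a) + (b + N * centre N b) = (a + b) + N * (centre N a + centre N b) by ring,
      circAbs_add_mul]
  rw [h1]
  calc circAbs N ((a + N * centre N a) + (b + N * centre N b))
      ≤ |(a + N * centre N a) + (b + N * centre N b)| := circAbs_le_abs hN _
    _ ≤ |a + N * centre N a| + |b + N * centre N b| := abs_add_le _ _
    _ = circAbs N a + circAbs N b := by rw [abs_add_mul_centre hN, abs_add_mul_centre hN]

variable {d : ℕ}

/-- The sites of the discrete torus `Π_{i<d} ℤ/P_iℤ` with period vector `P` (B6's `T^{(k)}`, `T_η`, … have this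
shape after choosing coordinates). [folklore] -/
abbrev TSite (d : ℕ) (P : Fin d → ℕ) : Type := (i : Fin d) → Fin (P i)

/-- The `i`-th circular coordinate distance `dist(x_i − y_i, P_iℤ)` as a natural number. [folklore] -/
def ccoord (P : Fin d → ℕ) (x y : TSite d P) (i : Fin d) : ℕ :=
  (circAbs (P i) (((x i).val : ℤ) - ((y i).val : ℤ))).toNat

/-- **The torus distance** `tdist P x y = max_i dist(x_i − y_i, P_iℤ)` — the sup-distance of the discrete torus
(real-valued; `0` for `d = 0`). [folklore] -/
def tdist (P : Fin d → ℕ) (x y : TSite d P) : ℝ := ((Finset.univ.sup (ccoord P x y) : ℕ) : ℝ)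

/-- The coordinate distance as an integer is `circAbs`. [folklore] -/
theorem ccoord_cast {P : Fin d → ℕ} (hP : ∀ i, 1 ≤ P i) (x y : TSite d P) (i : Fin d) :
    ((ccoord P x y i : ℕ) : ℤ) = circAbs (P i) (((x i).val : ℤ) - ((y i).val : ℤ)) :=
  Int.toNat_of_nonneg (circAbs_nonneg (hP i) _)

/-- Coordinate distances are symmetric. [folklore] -/
theorem ccoord_symm {P : Fin d → ℕ} (hP : ∀ i, 1 ≤ P i) (x y : TSite d P) (i : Fin d) :
    ccoord P x y i = ccoord P y x i := by
  unfold ccoord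
  rw [show ((x i).val : ℤ) - ((y i).val : ℤ) = -(((y i).val : ℤ) - ((x i).val : ℤ)) by ring,
    circAbs_neg (hP i)]

/-- Coordinate distances vanish on the diagonal. [folklore] -/
theorem ccoord_self (P : Fin d → ℕ) (x : TSite d P) (i : Fin d) : ccoord P x x i = 0 := by
  unfold ccoord
  rw [sub_self, circAbs_zero]
  rfl

/-- Coordinate distances satisfy the triangle inequality. [folklore] -/
theorem ccoord_triangle {P : Fin d → ℕ} (hP : ∀ i, 1 ≤ P i) (x y z : TSite d P) (i : Fin d) :
    ccoord P x z i ≤ ccoord P x y i + ccoord P y z i := by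
  have h := circAbs_add_le (hP i) (((x i).val : ℤ) - ((y i).val : ℤ)) (((y i).val : ℤ) - ((z i).val : ℤ))
  rw [show ((x i).val : ℤ) - ((y i).val : ℤ) + (((y i).val : ℤ) - ((z i).val : ℤ)) =
    ((x i).val : ℤ) - ((z i).val : ℤ) by ring] at h
  have h' : ((ccoord P x z i : ℕ) : ℤ) ≤ ((ccoord P x y i : ℕ) : ℤ) + ((ccoord P y z i : ℕ) : ℤ) := by
    rw [ccoord_cast hP, ccoord_cast hP, ccoord_cast hP]; exact h
  exact_mod_cast h'

/-- The torus distance is symmetric. [folklore] -/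
theorem tdist_symm {P : Fin d → ℕ} (hP : ∀ i, 1 ≤ P i) (x y : TSite d P) : tdist P x y = tdist P y x := by
  unfold tdist
  congr 2
  funext i
  exact ccoord_symm hP x y i

/-- The torus distance vanishes on the diagonal. [folklore] -/
theorem tdist_self (P : Fin d → ℕ) (x : TSite d P) : tdist P x x = 0 := by
  unfold tdist
  have : Finset.univ.sup (ccoord P x x) = 0 := by
    apply le_antisymm _ (Nat.zero_le _)
    exact Finset.sup_le fun i _ => (ccoord_self P x i).le
  rw [this, Nat.cast_zero]

/-- The torus distance satisfies the triangle inequality. [folklore] -/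
theorem tdist_triangle {P : Fin d → ℕ} (hP : ∀ i, 1 ≤ P i) (x y z : TSite d P) :
    tdist P x z ≤ tdist P x y + tdist P y z := by
  unfold tdist
  have h : Finset.univ.sup (ccoord P x z) ≤ Finset.univ.sup (ccoord P x y) + Finset.univ.sup (ccoord P y z) := by
    apply Finset.sup_le
    intro i hi
    exact (ccoord_triangle hP x y z i).trans
      (add_le_add (Finset.le_sup (f := ccoord P x y) hi) (Finset.le_sup (f := ccoord P y z) hi))
  exact_mod_cast h

/-- The torus distance is nonnegative. [folklore] -/
theorem tdist_nonneg (P : Fin d → ℕ) (x y : TSite d P) : 0 ≤ tdist P x y := by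
  unfold tdist; positivity

/-- Each circular coordinate distance is at most the torus distance. [folklore] -/
theorem circAbs_le_tdist {P : Fin d → ℕ} (hP : ∀ i, 1 ≤ P i) (x y : TSite d P) (i : Fin d) :
    (circAbs (P i) (((x i).val : ℤ) - ((y i).val : ℤ)) : ℝ) ≤ tdist P x y := by
  unfold tdist
  have h1 : ccoord P x y i ≤ Finset.univ.sup (ccoord P x y) := Finset.le_sup (Finset.mem_univ i)
  have h2 : ((ccoord P x y i : ℕ) : ℝ) ≤ ((Finset.univ.sup (ccoord P x y) : ℕ) : ℝ) := by exact_mod_cast h1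
  have h3 : ((ccoord P x y i : ℕ) : ℝ) = (circAbs (P i) (((x i).val : ℤ) - ((y i).val : ℤ)) : ℝ) := by
    have := ccoord_cast hP x y i
    exact_mod_cast this
  linarith

/-- **One-dimensional torus sums, uniformly in the period**: for `M ≥ 1`, every centre `c ∈ ℤ` and rate `b > 0`,
`Σ_{t ∈ ℤ/Mℤ} e^{−b·dist(c − t, Mℤ)} ≤ 2(1 − e^{−b})⁻¹` (the classes `c − t` have distinct centred representatives,
whose absolute values are the circular distances; then `B4Sect5Proof.sum_exp_neg_abs_le`). [folklore] -/
theorem torusSum1_le {M : ℕ} (hM : 1 ≤ M) (c : ℤ) {b : ℝ} (hb : 0 < b) :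
    ∑ t : Fin M, Real.exp (-(b * (circAbs M (c - (t.val : ℤ)) : ℝ))) ≤ 2 * (1 - Real.exp (-b))⁻¹ := by
  classical
  set φ : Fin M → ℤ := fun t => (c - (t.val : ℤ)) + M * centre M (c - (t.val : ℤ)) with hφ
  have hφabs : ∀ t : Fin M, |φ t| = circAbs M (c - (t.val : ℤ)) := fun t => abs_add_mul_centre hM _
  have hφinj : Function.Injective φ := by
    intro t t' h
    have hmod : ∀ s : Fin M, φ s % (M : ℤ) = (c - (s.val : ℤ)) % (M : ℤ) := fun s => by
      simp only [hφ]; exact Int.add_mul_emod_self_left _ _ _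
    have h1 : Int.ModEq (M : ℤ) (c - (t.val : ℤ)) (c - (t'.val : ℤ)) := by
      show (c - (t.val : ℤ)) % (M : ℤ) = (c - (t'.val : ℤ)) % (M : ℤ)
      rw [← hmod t, ← hmod t', h]
    obtain ⟨k, hk⟩ := h1.dvd
    have ht : (t.val : ℤ) < M := by exact_mod_cast t.isLt
    have ht' : (t'.val : ℤ) < M := by exact_mod_cast t'.isLt
    have h0 : (0 : ℤ) ≤ t.val := by positivity
    have h0' : (0 : ℤ) ≤ t'.val := by positivity
    have hk' : (t.val : ℤ) - (t'.val : ℤ) = M * k := by linarith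
    have hk0 : k = 0 := by
      rcases lt_trichotomy k 0 with hk1 | hk1 | hk1
      · have : (M : ℤ) * k ≤ -M := by nlinarith
        linarith
      · exact hk1
      · have : (M : ℤ) ≤ M * k := by nlinarith
        linarith
    rw [hk0, mul_zero, sub_eq_zero] at hk'
    exact Fin.ext (by exact_mod_cast hk')
  have step1 : ∑ t : Fin M, Real.exp (-(b * (circAbs M (c - (t.val : ℤ)) : ℝ))) =
      ∑ t : Fin M, Real.exp (-(b * |((0 : ℤ) : ℝ) - (φ t : ℝ)|)) := by
    apply Finset.sum_congr rfl
    intro t _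
    rw [← hφabs t, Int.cast_zero, zero_sub, abs_neg, Int.cast_abs]
  have step2 : ∑ t : Fin M, Real.exp (-(b * |((0 : ℤ) : ℝ) - (φ t : ℝ)|)) =
      ∑ r ∈ Finset.univ.image φ, Real.exp (-(b * |((0 : ℤ) : ℝ) - (r : ℝ)|)) := by
    rw [Finset.sum_image (fun x _ y _ h => hφinj h)]
  rw [step1, step2]
  exact B4Sect5Proof.sum_exp_neg_abs_le _ 0 hb

/-- **Uniform lattice sums on the torus** (sup-circular distance): for every period vector `P` (all `P i ≥ 1`),
every site `x` and `a > 0`, `Σ_{y ∈ Π_iℤ/P_iℤ} e^{−a·tdist(x,y)} ≤ K_d(a) = (2(1 − e^{−a/d})⁻¹)^d` — the SAME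
constant as for ℤ^d (`B4Sect5Proof.latticeConst`), independent of `P` and `x`. [folklore] -/
theorem torusSum_le (d : ℕ) {P : Fin d → ℕ} (hP : ∀ i, 1 ≤ P i) {a : ℝ} (ha : 0 < a) (x : TSite d P) :
    ∑ y : TSite d P, Real.exp (-(a * tdist P x y)) ≤ B4Sect5Proof.latticeConst d a := by
  classical
  -- coordinatewise comparison
  have hcoord : ∀ y : TSite d P, Real.exp (-(a * tdist P x y)) ≤
      ∏ i, Real.exp (-(a / d * (circAbs (P i) (((x i).val : ℤ) - ((y i).val : ℤ)) : ℝ))) := by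
    intro y
    rw [← Real.exp_sum]
    apply Real.exp_le_exp.mpr
    have hsum : ∑ i : Fin d, a / d * (circAbs (P i) (((x i).val : ℤ) - ((y i).val : ℤ)) : ℝ) ≤
        a * tdist P x y := by
      calc ∑ i : Fin d, a / d * (circAbs (P i) (((x i).val : ℤ) - ((y i).val : ℤ)) : ℝ)
          ≤ ∑ _i : Fin d, a / d * tdist P x y := by
            apply Finset.sum_le_sum
            intro i _
            exact mul_le_mul_of_nonneg_left (circAbs_le_tdist hP x y i)
              (div_nonneg ha.le (Nat.cast_nonneg d))
        _ = (d : ℝ) * (a / d * tdist P x y) := by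
            rw [Finset.sum_const, Finset.card_univ, Fintype.card_fin, nsmul_eq_mul]
        _ ≤ a * tdist P x y := by
            rcases Nat.eq_zero_or_pos d with h0 | hpos
            · subst h0; simp; exact mul_nonneg ha.le (tdist_nonneg P x y)
            · have : (d : ℝ) ≠ 0 := by exact_mod_cast hpos.ne'
              rw [show (d : ℝ) * (a / d * tdist P x y) = a * tdist P x y by field_simp]
    rw [Finset.sum_neg_distrib]
    linarith
  calc ∑ y : TSite d P, Real.exp (-(a * tdist P x y))
      ≤ ∑ y : TSite d P, ∏ i, Real.exp (-(a / d * (circAbs (P i) (((x i).val : ℤ) - ((y i).val : ℤ)) : ℝ))) :=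
        Finset.sum_le_sum fun y _ => hcoord y
    _ = ∏ i : Fin d, ∑ t : Fin (P i), Real.exp (-(a / d * (circAbs (P i) (((x i).val : ℤ) - (t.val : ℤ)) : ℝ))) :=
        (Fintype.prod_sum (fun i (t : Fin (P i)) =>
          Real.exp (-(a / d * (circAbs (P i) (((x i).val : ℤ) - (t.val : ℤ)) : ℝ))))).symm
    _ ≤ ∏ _i : Fin d, 2 * (1 - Real.exp (-(a / d)))⁻¹ := by
        apply Finset.prod_le_prod
        · intro i _; exact Finset.sum_nonneg fun t _ => (Real.exp_pos _).le
        · intro i _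
          have hd : 0 < (d : ℝ) := by exact_mod_cast Fin.pos i
          exact torusSum1_le (hP i) ((x i).val : ℤ) (div_pos ha hd)
    _ = B4Sect5Proof.latticeConst d a := by
        rw [Finset.prod_const, Finset.card_univ, Fintype.card_fin]; rfl

/-! ## §9  The Sect. 5 Theorem ON THE TORUS, verbatim shape, constants independent of the torus size -/

variable {N : ℕ}

/-- The index set of `φ : Ω → ℝ^N` for a region `Ω` of the discrete torus (Ω = the whole torus allowed): a site of
Ω and a component — the torus counterpart of `B4.Idx`. [folklore] -/
abbrev TIdx (P : Fin d → ℕ) (Ω : Finset (TSite d P)) (N : ℕ) : Type := ↥Ω × Fin N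

/-- The inclusion Λ ⊆ Ω on torus indices (counterpart of `B4.inclIdx`). [folklore] -/
def tinclIdx {P : Fin d → ℕ} {Ω Λ : Finset (TSite d P)} (h : Λ ⊆ Ω) : TIdx P Λ N → TIdx P Ω N :=
  fun p => (⟨p.1.1, h p.1.2⟩, p.2)

/-- The inclusion of torus indices is injective. [folklore] -/
theorem tinclIdx_injective {P : Fin d → ℕ} {Ω Λ : Finset (TSite d P)} (h : Λ ⊆ Ω) :
    Function.Injective (tinclIdx (N := N) h) := by
  intro p q hpq
  simp only [tinclIdx, Prod.mk.injEq, Subtype.mk.injEq] at hpq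
  exact Prod.ext (Subtype.ext hpq.1) hpq.2

/-- "A_Λ = ΛAΛ" on the torus: the compression of a kernel on Ω to Λ ⊆ Ω (counterpart of `B4.compress`). [cite: Balaban1983RegularityDecay, Sect. 5 Theorem p.594] -/
def tcompress {P : Fin d → ℕ} {Ω Λ : Finset (TSite d P)} (h : Λ ⊆ Ω)
    (A : Matrix (TIdx P Ω N) (TIdx P Ω N) ℝ) : Matrix (TIdx P Λ N) (TIdx P Λ N) ℝ :=
  A.submatrix (tinclIdx h) (tinclIdx h)

/-- The torus distance from a site to a finite set of sites, `min_{z∈S} tdist(x,z)`; `0` for the empty set (the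
convention of `Metric.infDist`, harmless exactly as in `B4.Concl57_58`). [folklore] -/
noncomputable def tsetDist (P : Fin d → ℕ) (x : TSite d P) (S : Finset (TSite d P)) : ℝ :=
  if hS : S.Nonempty then S.inf' hS (fun z => tdist P x z) else 0

/-- `tsetDist` is nonnegative. [folklore] -/
theorem tsetDist_nonneg (P : Fin d → ℕ) (x : TSite d P) (S : Finset (TSite d P)) : 0 ≤ tsetDist P x S := by
  unfold tsetDist
  split_ifs with hS
  · exact (Finset.le_inf'_iff hS _).mpr fun z _ => tdist_nonneg P x z
  · exact le_rfl

/-- `tsetDist x S ≤ tdist(x, z)` for `z ∈ S`. [folklore] -/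
theorem tsetDist_le_of_mem (P : Fin d → ℕ) (x : TSite d P) {S : Finset (TSite d P)} {z : TSite d P}
    (hz : z ∈ S) : tsetDist P x S ≤ tdist P x z := by
  unfold tsetDist
  rw [dif_pos ⟨z, hz⟩]
  exact Finset.inf'_le _ hz

/-- `tsetDist(·, S)` is `tdist`-Lipschitz: `tsetDist x S ≤ tdist(x,y) + tsetDist y S`. [folklore] -/
theorem tsetDist_le_tdist_add {P : Fin d → ℕ} (hP : ∀ i, 1 ≤ P i) (x y : TSite d P) (S : Finset (TSite d P)) :
    tsetDist P x S ≤ tdist P x y + tsetDist P y S := by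
  by_cases hS : S.Nonempty
  · obtain ⟨z, hz, hmin⟩ := Finset.exists_mem_eq_inf' hS (fun z => tdist P y z)
    have h1 : tsetDist P y S = tdist P y z := by unfold tsetDist; rw [dif_pos hS, hmin]
    rw [h1]
    exact (tsetDist_le_of_mem P x hz).trans (tdist_triangle hP x y z)
  · have h1 : tsetDist P x S = 0 := by unfold tsetDist; rw [dif_neg hS]
    have h2 : tsetDist P y S = 0 := by unfold tsetDist; rw [dif_neg hS]
    rw [h1, h2, add_zero]
    exact tdist_nonneg P x y

/-- The pseudo-distance on torus indices: the torus distance of the underlying sites. [folklore] -/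
def trho (P : Fin d → ℕ) (Ω : Finset (TSite d P)) (N : ℕ) : TIdx P Ω N → TIdx P Ω N → ℝ :=
  fun p q => tdist P p.1.1 q.1.1

/-- `trho` is a pseudo-distance. [folklore] -/
theorem trho_isPseudoDist {P : Fin d → ℕ} (hP : ∀ i, 1 ≤ P i) (Ω : Finset (TSite d P)) (N : ℕ) :
    IsPseudoDist (trho P Ω N) :=
  ⟨fun _ _ => tdist_symm hP _ _, fun _ => tdist_self P _, fun _ _ _ => tdist_triangle hP _ _ _⟩

/-- **Torus index sums, uniformly in the period vector and the region**: `Σ_{q ∈ Ω×Fin N} e^{−a·tdist(x, q)} ≤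
N·K_d(a)`. [folklore] -/
theorem torusIdxSum_le {P : Fin d → ℕ} (hP : ∀ i, 1 ≤ P i) (Ω : Finset (TSite d P)) (N : ℕ) {a : ℝ}
    (ha : 0 < a) (x : TSite d P) :
    ∑ q : TIdx P Ω N, Real.exp (-(a * tdist P x q.1.1)) ≤ N * B4Sect5Proof.latticeConst d a := by
  classical
  rw [Fintype.sum_prod_type]
  simp only [Finset.sum_const, Finset.card_univ, Fintype.card_fin, nsmul_eq_mul]
  rw [← Finset.mul_sum]
  apply mul_le_mul_of_nonneg_left _ (Nat.cast_nonneg N)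
  rw [Finset.sum_coe_sort Ω (fun y : TSite d P => Real.exp (-(a * tdist P x y)))]
  exact (Finset.sum_le_sum_of_subset_of_nonneg (Finset.subset_univ Ω)
    (fun _ _ _ => (Real.exp_pos _).le)).trans (torusSum_le d hP ha x)

/-- The profile bound on torus indices with `K(a) = N·K_d(a)`. [folklore] -/
theorem trho_sumBound {P : Fin d → ℕ} (hP : ∀ i, 1 ≤ P i) (Ω : Finset (TSite d P)) (N : ℕ) :
    SumBound (trho P Ω N) (fun a => N * B4Sect5Proof.latticeConst d a) :=
  fun _ ha p => torusIdxSum_le hP Ω N ha p.1.1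

/-- The ℤ^d/torus profile `K(a) = N·K_d(a)` is nonnegative. [folklore] -/
theorem profile_nonneg (d N : ℕ) : ∀ a : ℝ, 0 < a → 0 ≤ (N : ℝ) * B4Sect5Proof.latticeConst d a :=
  fun _ ha => mul_nonneg (Nat.cast_nonneg N) (B4Sect5Proof.latticeConst_nonneg d ha.le)

/-- Condition **(5.6)** on a torus region Ω (verbatim shape of `B4.Hyp56`, torus distance): *"A ≥ γ₀I, |A(x,x′)| ≤
c₀e^{−δ₀|x−x′|}, x, x′ ∈ Ω"*, A symmetric. [cite: Balaban1983RegularityDecay, (5.6) p.594] -/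
def TorusHyp56 {P : Fin d → ℕ} (Ω : Finset (TSite d P)) (A : Matrix (TIdx P Ω N) (TIdx P Ω N) ℝ)
    (γ₀ c₀ δ₀ : ℝ) : Prop :=
  Hyp56 (trho P Ω N) A γ₀ c₀ δ₀

/-- Conclusions **(5.7)–(5.8)** on a torus region for one Λ ⊆ Ω (verbatim shape of `B4.Concl57_58`; `Λᶜ = Ω ∖ Λ`,
"the complement Λᶜ of Λ in Ω", p. 596; torus distances). [cite: Balaban1983RegularityDecay, (5.7)–(5.8) p.594] -/
def TorusConcl57_58 {P : Fin d → ℕ} (Ω Λ : Finset (TSite d P)) (h : Λ ⊆ Ω)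
    (A : Matrix (TIdx P Ω N) (TIdx P Ω N) ℝ) (c₁ δ₁ : ℝ) : Prop :=
  (∀ p q : TIdx P Λ N, |(tcompress h A)⁻¹ p q| ≤ c₁ * Real.exp (-(δ₁ * tdist P p.1.1 q.1.1))) ∧
  (∀ p q : TIdx P Λ N, |(tcompress h A)⁻¹ p q - A⁻¹ (tinclIdx h p) (tinclIdx h q)| ≤
      c₁ * Real.exp (-(δ₁ * (tdist P p.1.1 q.1.1 + tsetDist P p.1.1 (Ω \ Λ) + tsetDist P q.1.1 (Ω \ Λ)))))

/-- Condition **(5.9)** on a torus region (`Ωᶜ` = torus ∖ Ω; for Ω = the whole torus the boundary terms vanish).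
[cite: Balaban1983RegularityDecay, (5.9) p.594] -/
def TorusHyp59 {P : Fin d → ℕ} (Ω : Finset (TSite d P)) (B : Matrix (TIdx P Ω N) (TIdx P Ω N) ℝ)
    (c₀ δ₀ : ℝ) : Prop :=
  Hyp59 (trho P Ω N) (fun p => tsetDist P p.1.1 (Finset.univ \ Ω)) B c₀ δ₀

/-- Conclusion **(5.10)** on a torus region for one Λ ⊆ Ω. [cite: Balaban1983RegularityDecay, (5.10) p.594] -/
def TorusConcl510 {P : Fin d → ℕ} (Ω Λ : Finset (TSite d P)) (h : Λ ⊆ Ω)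
    (A B : Matrix (TIdx P Ω N) (TIdx P Ω N) ℝ) (c₁ δ₁ : ℝ) : Prop :=
  ∀ p q : TIdx P Λ N, |(tcompress h A)⁻¹ p q - (tcompress h (A + B))⁻¹ p q| ≤
    c₁ * Real.exp (-(δ₁ * (tdist P p.1.1 q.1.1 + tsetDist P p.1.1 (Finset.univ \ Ω)
      + tsetDist P q.1.1 (Finset.univ \ Ω))))

variable (d N)

/-- **The Sect. 5 Theorem of [3] ON THE TORUS, uniform reading** — the statement B6 invokes at (2.152)–(2.157) with
Λ = the whole lattice T^{(k)}: for all positive `γ₀, c₀, δ₀` THERE ARE positive `c₁, δ₁` such that FOR EVERY period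
vector `P` (every torus `Π_{i<d}ℤ/P_iℤ`, all `P i ≥ 1`), every region `Ω` of it, every `A` on `L²(Ω; ℝ^N)` with (5.6)
in the torus distance: (5.7)–(5.8) for all `Λ ⊆ Ω`, and (5.10) for all admissible `B` and all `Λ ⊆ Ω` — the constants
do not depend on the size of the torus.  TORUS READING of a theorem PRINTED for Ω ⊂ Z^d (row G-pv09g2-1 (vi));
proved below, not quoted. [cite: Balaban1983RegularityDecay, Sect. 5 Theorem p.594 + p.597; Balaban1984PropagatorsII, p.250] -/
def TorusSect5ThmUniform : Prop :=
  ∀ γ₀ c₀ δ₀ : ℝ, 0 < γ₀ → 0 < c₀ → 0 < δ₀ → ∃ c₁ δ₁ : ℝ, 0 < c₁ ∧ 0 < δ₁ ∧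
    ∀ (P : Fin d → ℕ), (∀ i, 1 ≤ P i) →
    ∀ (Ω : Finset (TSite d P)) (A : Matrix (TIdx P Ω N) (TIdx P Ω N) ℝ), TorusHyp56 Ω A γ₀ c₀ δ₀ →
      (∀ (Λ : Finset (TSite d P)) (h : Λ ⊆ Ω), TorusConcl57_58 Ω Λ h A c₁ δ₁) ∧
      (∀ B : Matrix (TIdx P Ω N) (TIdx P Ω N) ℝ, TorusHyp56 Ω (A + B) γ₀ c₀ δ₀ → TorusHyp59 Ω B c₀ δ₀ →
        ∀ (Λ : Finset (TSite d P)) (h : Λ ⊆ Ω), TorusConcl510 Ω Λ h A B c₁ δ₁)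

/-- The torus form of the unit-lattice ENGINE (`B6FromB4.UnitLatticeEngine` with ℤ^d ↦ torus): decay of the full
inverse `A⁻¹` with `(c₁, δ₁)` chosen before the torus, the region and the operator — the (S5) sentence *"It gives us
an exponential decay … for the operator (C\*Δ_kC)⁻¹"* on `T^{(k)}`. [cite: Balaban1984PropagatorsII, p.250] -/
def TorusEngine : Prop :=
  ∀ γ₀ c₀ δ₀ : ℝ, 0 < γ₀ → 0 < c₀ → 0 < δ₀ → ∃ c₁ δ₁ : ℝ, 0 < c₁ ∧ 0 < δ₁ ∧
    ∀ (P : Fin d → ℕ), (∀ i, 1 ≤ P i) →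
    ∀ (Ω : Finset (TSite d P)) (A : Matrix (TIdx P Ω N) (TIdx P Ω N) ℝ), TorusHyp56 Ω A γ₀ c₀ δ₀ →
      ∀ p q : TIdx P Ω N, |A⁻¹ p q| ≤ c₁ * Real.exp (-(δ₁ * tdist P p.1.1 q.1.1))

variable {d N}

/-- **The torus theorem with explicit constants**: the ℤ^d pair `(B4Sect5Proof.cStar d N, B4Sect5Proof.deltaStar d N)`
serves every torus. [cite: Balaban1983RegularityDecay, Sect. 5 Theorem (5.6)–(5.10) p.594] -/
theorem torusSect5_explicit {γ₀ c₀ δ₀ : ℝ} (hγ : 0 < γ₀) (hc : 0 < c₀) (hδ : 0 < δ₀)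
    {P : Fin d → ℕ} (hP : ∀ i, 1 ≤ P i) (Ω : Finset (TSite d P))
    (A : Matrix (TIdx P Ω N) (TIdx P Ω N) ℝ) (hA : TorusHyp56 Ω A γ₀ c₀ δ₀) :
    (∀ (Λ : Finset (TSite d P)) (h : Λ ⊆ Ω), TorusConcl57_58 Ω Λ h A
        (cSt (fun a => N * B4Sect5Proof.latticeConst d a) γ₀ c₀ δ₀)
        (dSt (fun a => N * B4Sect5Proof.latticeConst d a) γ₀ c₀ δ₀)) ∧
    (∀ B : Matrix (TIdx P Ω N) (TIdx P Ω N) ℝ, TorusHyp56 Ω (A + B) γ₀ c₀ δ₀ → TorusHyp59 Ω B c₀ δ₀ →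
      ∀ (Λ : Finset (TSite d P)) (h : Λ ⊆ Ω), TorusConcl510 Ω Λ h A B
        (cSt (fun a => N * B4Sect5Proof.latticeConst d a) γ₀ c₀ δ₀)
        (dSt (fun a => N * B4Sect5Proof.latticeConst d a) γ₀ c₀ δ₀)) := by
  have hK : ∀ a : ℝ, 0 < a → 0 ≤ (N : ℝ) * B4Sect5Proof.latticeConst d a := profile_nonneg d N
  have main := fun (Λ : Finset (TSite d P)) (h : Λ ⊆ Ω) =>
    sect5_uniform hK hγ hc hδ (trho_isPseudoDist hP Ω N) (trho_sumBound hP Ω N) hA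
      (tinclIdx_injective (N := N) h)
  refine ⟨fun Λ h => ⟨fun p q => (main Λ h).1 p q, fun p q => ?_⟩, fun B hAB hB Λ h p q => ?_⟩
  · refine (main Λ h).2.1 (fun p : TIdx P Λ N => tsetDist P p.1.1 (Ω \ Λ))
      (fun p => tsetDist_nonneg P _ _) ?_ p q
    intro i z hz
    apply tsetDist_le_of_mem
    rw [Finset.mem_sdiff]
    refine ⟨z.1.2, fun hzΛ => hz ⟨(⟨z.1.1, hzΛ⟩, z.2), ?_⟩⟩
    rfl
  · exact (main Λ h).2.2 B (fun p : TIdx P Ω N => tsetDist P p.1.1 (Finset.univ \ Ω)) hAB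
      (fun p => tsetDist_nonneg P _ _) (fun x y => tsetDist_le_tdist_add hP _ _ _) hB p q

/-- **THE SECT. 5 THEOREM OF [3] HOLDS ON THE TORUS**, uniformly in the torus (row G-pv09g2-1 (vi) closed at the
level of the theorem invoked). [cite: Balaban1983RegularityDecay, Sect. 5 Theorem p.594 + p.597; Balaban1984PropagatorsII, p.250] -/
theorem torusSect5ThmUniform_holds (d N : ℕ) : TorusSect5ThmUniform d N := by
  intro γ₀ c₀ δ₀ hγ hc hδ
  refine ⟨cSt (fun a => N * B4Sect5Proof.latticeConst d a) γ₀ c₀ δ₀,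
    dSt (fun a => N * B4Sect5Proof.latticeConst d a) γ₀ c₀ δ₀,
    cSt_pos _ c₀ δ₀ hγ, dSt_pos (profile_nonneg d N) hγ hc.le hδ, ?_⟩
  intro P hP Ω A hA
  exact torusSect5_explicit hγ hc hδ hP Ω A hA

variable (d N : ℕ) in
/-- `TorusSect5ThmUniform` — `_holds` alias of `torusSect5ThmUniform_holds` above under the fact's exact name, stated under the
prover's own binders as section variables (appended 2026-08-28, D-0026 bookkeeping: the proof term is the
existing theorem of this file; no statement, definition or attribute is edited; no new named fact; the
ledger's debt table listed the fact unproved). [cite: Balaban1983RegularityDecay, Sect. 5 Theorem p.594 + p.597; Balaban1984PropagatorsII, p.250] -/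
theorem _root_.Literature.MathematicalPhysics.QuantumFieldTheory.Balaban1983to89.B4Sect5Torus.TorusSect5ThmUniform_holds :
    _root_.Literature.MathematicalPhysics.QuantumFieldTheory.Balaban1983to89.B4Sect5Torus.TorusSect5ThmUniform d N :=
  _root_.Literature.MathematicalPhysics.QuantumFieldTheory.Balaban1983to89.B4Sect5Torus.torusSect5ThmUniform_holds (d := d) (N := N)

/-- The torus ENGINE holds (with `c₁ = 2/γ₀`, `δ₁ = rate`). [cite: Balaban1984PropagatorsII, p.250] -/
theorem torusEngine_holds (d N : ℕ) : TorusEngine d N := by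
  intro γ₀ c₀ δ₀ hγ hc hδ
  refine ⟨2 / γ₀, rate (fun a => N * B4Sect5Proof.latticeConst d a) γ₀ c₀ δ₀, by positivity,
    rate_pos (profile_nonneg d N) hγ hc.le hδ, ?_⟩
  intro P hP Ω A hA p q
  exact inv_decay (profile_nonneg d N) hγ hc.le hδ (trho_isPseudoDist hP Ω N) (trho_sumBound hP Ω N) hA p q

variable (d N : ℕ) in
/-- `TorusEngine` — `_holds` alias of `torusEngine_holds` above under the fact's exact name, stated under the
prover's own binders as section variables (appended 2026-08-28, D-0026 bookkeeping: the proof term is the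
existing theorem of this file; no statement, definition or attribute is edited; no new named fact; the
ledger's debt table listed the fact unproved). [cite: Balaban1984PropagatorsII, p.250] -/
theorem _root_.Literature.MathematicalPhysics.QuantumFieldTheory.Balaban1983to89.B4Sect5Torus.TorusEngine_holds :
    _root_.Literature.MathematicalPhysics.QuantumFieldTheory.Balaban1983to89.B4Sect5Torus.TorusEngine d N :=
  _root_.Literature.MathematicalPhysics.QuantumFieldTheory.Balaban1983to89.B4Sect5Torus.torusEngine_holds (d := d) (N := N)

/-- The torus constants ARE the ℤ^d constants of `B4Sect5Proof.sect5_explicit`. [folklore] -/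
theorem constants_agree_cStar (d N : ℕ) (γ₀ c₀ δ₀ : ℝ) :
    cSt (fun a => N * B4Sect5Proof.latticeConst d a) γ₀ c₀ δ₀ = B4Sect5Proof.cStar d N γ₀ c₀ δ₀ := rfl

/-- The torus rate IS the ℤ^d rate of `B4Sect5Proof.sect5_explicit`. [folklore] -/
theorem constants_agree_deltaStar (d N : ℕ) (γ₀ c₀ δ₀ : ℝ) :
    dSt (fun a => N * B4Sect5Proof.latticeConst d a) γ₀ c₀ δ₀ = B4Sect5Proof.deltaStar d N γ₀ c₀ δ₀ := rfl

end Torus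

/-! ## §10  Consistency: the printed ℤ^d setting `B4.Idx Ω N` is an instance (constants `rfl`-equal to pv23's) -/

section Zd

variable {d N : ℕ}

/-- The pseudo-distance on `B4.Idx Ω N`: the sup-distance of ℤ^d of the underlying sites. [folklore] -/
def zrho (Ω : Finset (Fin d → ℤ)) (N : ℕ) : B4.Idx Ω N → B4.Idx Ω N → ℝ :=
  fun p q => dist (p.1 : Fin d → ℤ) (q.1 : Fin d → ℤ)

/-- `zrho` is a pseudo-distance. [folklore] -/
theorem zrho_isPseudoDist (Ω : Finset (Fin d → ℤ)) (N : ℕ) : IsPseudoDist (zrho Ω N) :=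
  ⟨fun _ _ => dist_comm _ _, fun _ => dist_self _, fun _ _ _ => dist_triangle _ _ _⟩

/-- The profile bound on `B4.Idx Ω N` with `K(a) = N·K_d(a)` (`B4Sect5Proof.idxSum_le`). [folklore] -/
theorem zrho_sumBound (Ω : Finset (Fin d → ℤ)) (N : ℕ) :
    SumBound (zrho Ω N) (fun a => N * B4Sect5Proof.latticeConst d a) :=
  fun _ ha p => B4Sect5Proof.idxSum_le ha Ω (p.1 : Fin d → ℤ)

/-- `B4.Hyp56` is `Hyp56` for `zrho`, on the nose. [folklore] -/
theorem hyp56_iff_B4 (Ω : Finset (Fin d → ℤ)) (A : Matrix (B4.Idx Ω N) (B4.Idx Ω N) ℝ) (γ₀ c₀ δ₀ : ℝ) :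
    B4.Hyp56 Ω A γ₀ c₀ δ₀ ↔ Hyp56 (zrho Ω N) A γ₀ c₀ δ₀ := Iff.rfl

/-- The ℤ^d boundary potential of (5.8), `β = dist(·, Ω ∖ Λ)` on `B4.Idx Λ N`, is admissible for `sect5_uniform`
along `B4.inclIdx h`: it is dominated by the distance to every index outside the range. (With `zrho_isPseudoDist`,
`zrho_sumBound`, `hyp56_iff_B4`, `constants_agree_cStar/deltaStar` this exhibits the printed ℤ^d theorem
`B4.Sect5ThmUniform d N` — already landed as `B4Sect5Proof.sect5ThmUniform_holds`, not re-derived here — as the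
instance `n = B4.Idx Ω N`, `K(a) = N·K_d(a)` of `sect5_uniform`.) [folklore] -/
theorem zd_beta_admissible {Ω Λ : Finset (Fin d → ℤ)} (h : Λ ⊆ Ω) (i : B4.Idx Λ N) (z : B4.Idx Ω N)
    (hz : ¬ ∃ j, B4.inclIdx h j = z) :
    Metric.infDist (i.1 : Fin d → ℤ) (((Ω \ Λ : Finset (Fin d → ℤ))) : Set (Fin d → ℤ)) ≤
      zrho Ω N (B4.inclIdx h i) z := by
  apply Metric.infDist_le_dist_of_mem
  rw [Finset.coe_sdiff]
  refine ⟨z.1.2, fun hzΛ => hz ⟨(⟨(z.1 : Fin d → ℤ), hzΛ⟩, z.2), ?_⟩⟩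
  rfl

/-- The ℤ^d boundary potential of (5.9)/(5.10), `ω = dist(·, ℤ^d ∖ Ω)`, is `zrho`-Lipschitz. [folklore] -/
theorem zd_omega_lipschitz (Ω : Finset (Fin d → ℤ)) (x y : B4.Idx Ω N) :
    Metric.infDist (x.1 : Fin d → ℤ) ((Ω : Set (Fin d → ℤ)))ᶜ ≤
      zrho Ω N x y + Metric.infDist (y.1 : Fin d → ℤ) ((Ω : Set (Fin d → ℤ)))ᶜ := by
  have := Metric.infDist_le_infDist_add_dist (x := (x.1 : Fin d → ℤ)) (y := (y.1 : Fin d → ℤ))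
    (s := ((Ω : Set (Fin d → ℤ)))ᶜ)
  unfold zrho
  linarith

end Zd

end Literature.MathematicalPhysics.QuantumFieldTheory.Balaban1983to89.B4Sect5Torus
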